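import Mathlib
import Literature.NumberTheory.DiophantineGeometry.MultiplicativeGroupApproximationMinkowskiProofs
import Literature.Barriers.ABC.BakerMethodBoundsStewartTijdemanGenericProofs
import HarnessLib

/-!
# Proofs for `BakerMethodBounds`: the Stewart–Tijdeman shape `(15, 0)` from a `p`-adic bound for
# PRINCIPAL UNITS of `ℚ` (Theorem D)

`Literature/Barriers/ABC/BakerMethodBoundsPrincipalUnitsProofs.lean` — proofs companion of the
barrier file `Literature/Barriers/ABC/BakerMethodBounds.lean` (theorems only: no definition, no
named fact), continuing `BakerMethodBoundsStewartTijdemanGenericProofs.lean`. It concerns the named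
fact `stewartTijdeman1986_upperBound` (`BakerShapeBound 15 0`: an absolute `κ` with
`log c ≤ κ · R^{15}`, `R = rad(abc)`, for every abc triple — Stewart–Tijdeman 1986, as quoted by
Waldschmidt [cite: Waldschmidt2014, §2 (PDF p. 3)]).

Theorem A of the sibling file derived the fact from any `p`-adic bound of classical quality for
linear forms in the logarithms of DISTINCT PRIMES `q₁, …, qₙ ≠ p` (which are `p`-adic units, but
not principal units: `qᵢ ≢ 1 (mod p)` in general). Every proof of such a bound by Baker's method
(and the tree's formalisation of its `p`-adic analytic part, `Transcendental/BrumerPadic*`) works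
with PRINCIPAL units — numbers `β ≡ 1 (mod p^{m₀})`, on which the `p`-adic logarithm is the usual
series and `z ↦ β^z` is analytic on `ℤ_p` — and the passage from units to principal units is where
the dependence on `p` is decided (raising every `qᵢ` to the power `p − 1` costs `(p−1)ⁿ` in the
product of the heights, which no polynomial bound in the radical survives). This file performs that
passage once and for all, elementarily and with the loss of a single factor `p^{m₀}`:

* `stewartTijdeman1986_of_principalUnitPadicBound` (**Theorem D**): the fact follows from any
  bound, valid for every prime `p`, every `k ≥ 1`, all multiplicatively independent POSITIVE
  RATIONALS `β₁, …, β_k` with `ord_p(βⱼ − 1) ≥ m₀` and all `y ∈ (ℤ ∖ {0})^k`, of the shape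
  `ord_p(β₁^{y₁}⋯β_k^{y_k} − 1) ≤ K L^k k^{κk} p^σ (∏ⱼ max(1, h(βⱼ))) (log max(3, maxⱼ|yⱼ|))^τ`
  with `K ≥ 0`, `L ≥ 1`, `τ ∈ ℕ`, `κ ∈ [0, 13]`, `σ ≥ 0`, `m₀ ≥ 1`, `σ + m₀ ≤ 14` (the level
  `m₀` is the prover's choice: `m₀ = 1` for odd `p`, `m₀ = 2` uniformly, … all give the fact).

## The argument

For a prime `p`, distinct primes `q₁, …, qₙ ≠ p` and `m₀ ≥ 1`, the exponent vectors `x ∈ ℤⁿ` with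
`∏ qᵢ^{xᵢ} ≡ 1 (mod p^{m₀})` form the kernel `Λ₀` of `x ↦ ∏ q̄ᵢ^{xᵢ} ∈ (ℤ/p^{m₀})ˣ`, a subgroup
of index `N₀ ≤ #(ℤ/p^{m₀}) = p^{m₀}` (`exists_principal_lattice`; membership gives
`ord_p(∏ qᵢ^{xᵢ} − 1) ≥ m₀`, `le_padicValRat_of_prod_units_eq_one`). By Minkowski's second theorem
for `ℤⁿ` — PROVED in the tree as `Dioph.exists_directional_system_prod_mul_volume_le`
[cite: EvertseGyory2015, Thm 4.3.1 (p. 70)] — applied to the norm `x ↦ ‖Bx‖_∞` for a `ℤ`-basis `B`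
of `Λ₀` (unit ball of volume `2ⁿ/|det B| = 2ⁿ/N₀`), `Λ₀` contains `n` linearly independent
vectors `w₁, …, wₙ` with `∏ ‖w_k‖_∞ ≤ N₀` (`exists_indep_prod_norm_le_card_quotient`). The numbers
`β_k = ∏ qᵢ^{w_{k i}}` are multiplicatively independent positive principal units of level `m₀`
with `h(β_k) ≤ ‖w_k‖_∞ log ∏ qᵢ`, so `∏ max(1, h(β_k)) ≤ N₀ (2 log ∏ qᵢ)ⁿ`; with `D = det(w) ≠ 0`
and `y = e · adj(w)` one has `∑ y_k w_k = D e`, i.e. `∏ β_k^{y_k} = (∏ qᵢ^{eᵢ})^D`, and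
`ord_p(u − 1) ≤ ord_p(u^D − 1)` (`u − v ∣ u^d − v^d`); the `y_k` are bounded by
`n · max|eᵢ| · n! · N₀ⁿ`, so `log max(3, max|y_k|) ≤ 2n² m₀ log(3p) log max(3, max|eᵢ|)`
(`exists_principal_reduction`, `primeFamilyBound_of_principalUnitBound`). This gives a prime-family
bound with class function `F(n, ∏ qᵢ) G(p)`,
`F(n, P) = K (2m₀)^τ (2L)ⁿ n^{κn} n^{2τ} (log P)ⁿ`, `G(p) = p^{σ+m₀} (log 3p)^τ`, to which the
Stewart–Tijdeman summation of the sibling file applies verbatim (`sum_padicPart_le_general`: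
`x ∣ y² − z²`, `ord_p x ≤ ord_p((y/z)² − 1)`, summed against `log p`). The book-keeping against the
radical (`abc_log_le_of_principalClass`): `n^{κn} ≤ e^{κn} rad(ab)^κ`, `n^{2τ} ≤ 4^{τn}`,
`(log rad(ab))ⁿ ≤ (8e)ⁿ rad(ab)^{9/8}` (`log_prod_pow_card_le`), `Cⁿ ≤ A rad(ab)^{1/8}`,
`∑_{p ∣ c} p^{σ+m₀} (log 3p)^τ log p ≤ 24 (30(τ+1))^τ rad(c)^{σ+m₀+1/4}`, whence
`log c ≤ M rad(ab)^{κ+5/4} rad(c)^{σ+m₀+1/4} (log max(3, log c))^τ ≤ M R^{29/2} (log max(3, log c))^τ`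
for `κ ≤ 13`, `σ + m₀ ≤ 14`, and `bakerShapeBound_fifteen_of_loglog` concludes.

Nothing here is claimed to be in print beyond the summation (Stewart–Tijdeman 1986) and Minkowski's
theorem; the point of the file is to record, as a theorem, that the catalogue record
`stewartTijdeman1986_upperBound` needs ONLY a `p`-adic Baker-type bound for principal units of `ℚ`
with `k^{O(k)} p^{O(1)}` constants — the statement a `p`-adic transcendence development over `ℚ_p`
would most naturally prove first.

## References

* [StewartTijdeman1986] C. L. Stewart, R. Tijdeman, *On the Oesterlé–Masser conjecture*,
  Monatsh. Math. 102 (1986), 251–257 — Theorem 1 (upper bound), as quoted in [Waldschmidt2014].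
* [Waldschmidt2014] M. Waldschmidt, *Lecture on the abc conjecture and some of its consequences*,
  Springer Proc. Math. Stat. 98 (2015), §2 (PDF p. 3).
* [EvertseGyory2015] J.-H. Evertse, K. Győry, *Unit Equations in Diophantine Number Theory*, CUP
  2015 — Thm 4.3.1 (Minkowski's second theorem), p. 70.
-/

noncomputable section

open Finset Real Height MeasureTheory
open Literature.NumberTheory.DiophantineGeometry
open Literature.NumberTheory.DiophantineGeometry.Dioph

namespace Literature.Barriers.ABC

namespace StewartTijdemanPrincipal

/-! ### Geometry of numbers: short independent vectors in a sublattice of finite index -/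

/-- **Geometry of numbers: short independent vectors in a full-rank sublattice of `ℤⁿ`.** A
subgroup `Λ₀ ≤ ℤⁿ` (`n ≥ 1`) of finite index `N₀` contains `n` linearly independent vectors
`w₁, …, wₙ` with `‖w₁‖_∞ ⋯ ‖wₙ‖_∞ ≤ N₀`. Proof: with a `ℤ`-basis `B` of `Λ₀` (full rank since the
quotient is finite; `|det B| = N₀`), apply Minkowski's second theorem for `ℤⁿ`
(`exists_directional_system_prod_mul_volume_le`) to the norm `x ↦ ‖Bx‖_∞`, whose unit ball has
volume `2ⁿ/|det B|`, and put `w_k = B v_k`. [folklore] -/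
theorem exists_indep_prod_norm_le_card_quotient {n : ℕ} (hn : 0 < n)
    (Λ₀ : Submodule ℤ (Fin n → ℤ)) [Finite ((Fin n → ℤ) ⧸ Λ₀)] :
    ∃ w : Fin n → Fin n → ℤ, (∀ k, w k ∈ Λ₀) ∧
      LinearIndependent ℝ (fun k i => (w k i : ℝ)) ∧
      ∏ k, ‖fun i => (w k i : ℝ)‖ ≤ (Nat.card ((Fin n → ℤ) ⧸ Λ₀) : ℝ) := by
  classical
  -- full rank and a basis
  have hrank : Module.finrank ℤ Λ₀ = n := by
    have h := (Submodule.finiteQuotient_iff Λ₀).mp ‹_›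
    rw [h, Module.finrank_fin_fun]
  let bN : Module.Basis (Fin n) ℤ Λ₀ := Module.finBasisOfFinrankEq ℤ Λ₀ hrank
  -- the matrix of the basis (columns)
  set B : Matrix (Fin n) (Fin n) ℤ := Matrix.of fun i k => ((bN k : Λ₀) : Fin n → ℤ) i with hB
  -- `|det B| = #(ℤⁿ/Λ₀)`
  have hdet : B.det.natAbs = Nat.card ((Fin n → ℤ) ⧸ Λ₀) := by
    have h := Submodule.natAbs_det_basis_change (Pi.basisFun ℤ (Fin n)) Λ₀ bN
    rw [Module.Basis.det_apply] at h
    rw [← h]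
    congr 2
  have hcard_pos : 0 < Nat.card ((Fin n → ℤ) ⧸ Λ₀) := Nat.card_pos
  have hdet0 : B.det ≠ 0 := by
    intro h0
    rw [h0, Int.natAbs_zero] at hdet
    omega
  -- the real matrix and the linear map `T = B·`
  set Bℝ : Matrix (Fin n) (Fin n) ℝ := B.map (Int.cast : ℤ → ℝ) with hBℝ
  have hdetℝ : Bℝ.det = (B.det : ℝ) := by
    rw [hBℝ]; norm_cast
  have hdetℝ0 : Bℝ.det ≠ 0 := by rw [hdetℝ]; exact_mod_cast hdet0
  set T : (Fin n → ℝ) →ₗ[ℝ] (Fin n → ℝ) := Matrix.toLin' Bℝ with hT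
  have hTdet : LinearMap.det T = Bℝ.det := by rw [hT, LinearMap.det_toLin']
  have hTinj : Function.Injective T := by
    rw [hT]
    exact Matrix.mulVec_injective_iff_isUnit.mpr
      ((Matrix.isUnit_iff_isUnit_det _).mpr (isUnit_iff_ne_zero.mpr hdetℝ0))
  -- the norm `N x = ‖T x‖_∞`
  let N : Seminorm ℝ (Fin n → ℝ) := (normSeminorm ℝ (Fin n → ℝ)).comp T
  have N_apply : ∀ x, N x = ‖T x‖ := fun x => rfl
  have hN : ∀ x, N x = 0 → x = 0 := fun x hx => by
    rw [N_apply, norm_eq_zero] at hx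
    exact hTinj (by rw [hx, map_zero])
  obtain ⟨v, hli, -, -, hvol⟩ := exists_directional_system_prod_mul_volume_le hn N hN
  -- the volume of the unit ball of `N`
  have hball : {x : Fin n → ℝ | N x < 1} = T ⁻¹' Metric.ball 0 1 := by
    ext x; simp [N_apply]
  have hvolN : volume {x : Fin n → ℝ | N x < 1} =
      ENNReal.ofReal |(Bℝ.det)⁻¹| * ENNReal.ofReal ((2 : ℝ) ^ n) := by
    rw [hball, MeasureTheory.Measure.addHaar_preimage_linearMap volume
      (by rw [hTdet]; exact hdetℝ0), hTdet, Real.volume_pi_ball 0 one_pos]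
    simp [Fintype.card_fin]
  -- `∏ N(v_k) ≤ |det B|`
  set P : ℝ := ∏ k, N (fun i => (v k i : ℝ)) with hP
  have hP0 : 0 ≤ P := Finset.prod_nonneg fun k _ => apply_nonneg _ _
  have hD0 : 0 < |Bℝ.det| := abs_pos.mpr hdetℝ0
  have hPle : P ≤ |Bℝ.det| := by
    rw [hvolN] at hvol
    have h2n : (2 : ENNReal) ^ n = ENNReal.ofReal ((2 : ℝ) ^ n) := by
      rw [ENNReal.ofReal_pow (by norm_num), ENNReal.ofReal_ofNat]
    rw [h2n, ← ENNReal.ofReal_mul (abs_nonneg _), ← ENNReal.ofReal_mul hP0,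
      ENNReal.ofReal_le_ofReal_iff (by positivity)] at hvol
    have h2 : (0 : ℝ) < 2 ^ n := by positivity
    have h3 : P * |(Bℝ.det)⁻¹| ≤ 1 := le_of_mul_le_mul_right (by linarith) h2
    rw [abs_inv] at h3
    rwa [mul_inv_le_iff₀ hD0, one_mul] at h3
  -- the vectors `w_k = B v_k`
  refine ⟨fun k => B.mulVec (v k), fun k => ?_, ?_, ?_⟩
  · -- membership
    show B.mulVec (v k) ∈ Λ₀
    have hsum : B.mulVec (v k) = ∑ j, (v k j) • ((bN j : Λ₀) : Fin n → ℤ) := by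
      ext i
      simp [Matrix.mulVec, dotProduct, hB, Finset.sum_apply, mul_comm]
    rw [hsum]
    exact Submodule.sum_mem _ fun j _ => Submodule.smul_mem _ _ (bN j).2
  · -- linear independence over `ℝ`
    have hTw : (fun k i => ((B.mulVec (v k) i : ℤ) : ℝ)) = T ∘ (fun k i => (v k i : ℝ)) := by
      funext k i
      rw [Function.comp_apply, hT, Matrix.toLin'_apply]
      have := RingHom.map_mulVec (Int.castRingHom ℝ) B (v k) i
      simpa [hBℝ, Function.comp_def] using this
    rw [hTw]
    exact hli.map' T (LinearMap.ker_eq_bot.mpr hTinj)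
  · -- the product of the norms
    have hnorm : ∀ k, ‖fun i => ((B.mulVec (v k) i : ℤ) : ℝ)‖ = N (fun i => (v k i : ℝ)) := by
      intro k
      rw [N_apply, hT, Matrix.toLin'_apply]
      congr 1
      funext i
      have := RingHom.map_mulVec (Int.castRingHom ℝ) B (v k) i
      simpa [hBℝ, Function.comp_def] using this
    simp_rw [hnorm]
    calc P ≤ |Bℝ.det| := hPle
      _ = (B.det.natAbs : ℝ) := by
          rw [hdetℝ, Nat.cast_natAbs, Int.cast_abs]
      _ = (Nat.card ((Fin n → ℤ) ⧸ Λ₀) : ℝ) := by rw [hdet]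

/-- A product of integer powers of positive integers as a quotient of two natural numbers
(positive and negative parts of the exponents). [folklore] -/
theorem prod_zpow_eq_div {n : ℕ} (q : Fin n → ℕ) (hq0 : ∀ i, q i ≠ 0) (x : Fin n → ℤ) :
    ∏ i, ((q i : ℚ)) ^ x i =
      ((∏ i, q i ^ (x i).toNat : ℕ) : ℚ) / ((∏ i, q i ^ (-x i).toNat : ℕ) : ℚ) := by
  push_cast
  rw [← Finset.prod_div_distrib]
  refine Finset.prod_congr rfl fun i _ => ?_
  have hq : (q i : ℚ) ≠ 0 := by exact_mod_cast hq0 i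
  rw [← zpow_natCast, ← zpow_natCast, ← zpow_sub₀ hq]
  congr 1
  exact (Int.toNat_sub_toNat_neg (x i)).symm

/-- **Principal units of level `m₀` from a relation in `(ℤ/p^{m₀})ˣ`.** If `u_i ∈ (ℤ/p^{m₀})ˣ`
are the residues of primes `q_i ≠ p` and `∏ u_i^{x_i} = 1`, then the rational number
`ξ = ∏ q_i^{x_i}` satisfies `ord_p(ξ − 1) ≥ m₀` (unless `ξ = 1`): writing `ξ = U/V` with
`U = ∏ q_i^{x_i⁺}`, `V = ∏ q_i^{x_i⁻}` prime to `p`, the relation says `U ≡ V (mod p^{m₀})`, and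
`ord_p(U/V − 1) = ord_p(U − V)`. [folklore] -/
theorem le_padicValRat_of_prod_units_eq_one {n p m₀ : ℕ} (hp : p.Prime) {q : Fin n → ℕ}
    (hq : ∀ i, (q i).Prime) (hqp : ∀ i, q i ≠ p)
    (u : Fin n → (ZMod (p ^ m₀))ˣ)
    (hu : ∀ i, ((u i : (ZMod (p ^ m₀))ˣ) : ZMod (p ^ m₀)) = (q i : ZMod (p ^ m₀)))
    {x : Fin n → ℤ} (hx : ∏ i, u i ^ x i = 1) (hne : ∏ i, ((q i : ℚ)) ^ x i ≠ 1) :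
    (m₀ : ℤ) ≤ padicValRat p (∏ i, ((q i : ℚ)) ^ x i - 1) := by
  haveI := Fact.mk hp
  set U : ℕ := ∏ i, q i ^ (x i).toNat with hU
  set V : ℕ := ∏ i, q i ^ (-x i).toNat with hV
  have hq0 : ∀ i, q i ≠ 0 := fun i => (hq i).ne_zero
  have hU0 : U ≠ 0 := Finset.prod_ne_zero_iff.mpr fun i _ => pow_ne_zero _ (hq0 i)
  have hV0 : V ≠ 0 := Finset.prod_ne_zero_iff.mpr fun i _ => pow_ne_zero _ (hq0 i)
  have hndvd : ∀ (f : Fin n → ℕ), ¬ p ∣ ∏ i, q i ^ f i := by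
    intro f h
    have hp' : _root_.Prime p := Nat.prime_iff.mp hp
    obtain ⟨i, -, hi⟩ := (hp'.dvd_finsetProd_iff _).mp h
    have h1 : p ∣ q i := hp.dvd_of_dvd_pow hi
    exact hqp i ((Nat.prime_dvd_prime_iff_eq hp (hq i)).mp h1).symm
  have hpU : ¬ p ∣ U := hndvd _
  have hpV : ¬ p ∣ V := hndvd _
  have hprod : ∏ i, ((q i : ℚ)) ^ x i = (U : ℚ) / V := prod_zpow_eq_div q hq0 x
  -- the relation in the unit group: `∏ u^{x⁺} = ∏ u^{x⁻}`
  have hunits : (∏ i, u i ^ (x i).toNat) = ∏ i, u i ^ (-x i).toNat := by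
    have h1 : ∏ i, u i ^ x i = (∏ i, u i ^ (x i).toNat) * (∏ i, u i ^ (-x i).toNat)⁻¹ := by
      rw [← Finset.prod_inv_distrib, ← Finset.prod_mul_distrib]
      refine Finset.prod_congr rfl fun i _ => ?_
      rw [← zpow_natCast, ← zpow_natCast, ← zpow_neg, ← zpow_add]
      congr 1
      have := Int.toNat_sub_toNat_neg (x i)
      omega
    rw [h1] at hx
    exact mul_inv_eq_one.mp hx
  -- cast to `ℤ/p^{m₀}`
  have hUV : (U : ZMod (p ^ m₀)) = (V : ZMod (p ^ m₀)) := by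
    have h := congrArg (fun w : (ZMod (p ^ m₀))ˣ => (w : ZMod (p ^ m₀))) hunits
    simp only [Units.coe_prod, Units.val_pow_eq_pow_val, hu] at h
    rw [hU, hV]; push_cast; exact h
  -- `p^{m₀} ∣ U − V`
  have hdvd : ((p : ℤ)) ^ m₀ ∣ (U : ℤ) - V := by
    have h := (ZMod.intCast_eq_intCast_iff_dvd_sub (V : ℤ) (U : ℤ) (p ^ m₀)).mp
      (by push_cast; exact hUV.symm)
    push_cast at h
    exact h
  -- `U ≠ V`
  have hUV' : (U : ℤ) - V ≠ 0 := by
    intro h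
    have hUV2 : (U : ℚ) = V := by exact_mod_cast (sub_eq_zero.mp h)
    apply hne
    rw [hprod, hUV2, div_self (by exact_mod_cast hV0)]
  -- the valuation
  have hval : padicValRat p (∏ i, ((q i : ℚ)) ^ x i - 1) = padicValInt p ((U : ℤ) - V) := by
    rw [hprod]
    have hVQ : (V : ℚ) ≠ 0 := by exact_mod_cast hV0
    have h1 : (U : ℚ) / V - 1 = (((U : ℤ) - V : ℤ) : ℚ) / (V : ℚ) := by
      push_cast; field_simp
    rw [h1, padicValRat.div (by exact_mod_cast hUV') hVQ, padicValRat.of_int, padicValRat.of_nat,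
      padicValNat.eq_zero_of_not_dvd hpV]
    simp
  rw [hval]
  rcases (padicValInt_dvd_iff m₀ ((U : ℤ) - V)).mp hdvd with h | h
  · exact absurd h hUV'
  · exact_mod_cast h

/-- **The lattice of exponent vectors giving principal units of level `m₀`.** For a prime `p`,
`m₀ ∈ ℕ` and primes `q₁, …, qₙ ≠ p`, the exponent vectors `x ∈ ℤⁿ` with
`∏ qᵢ^{xᵢ} ≡ 1 (mod p^{m₀})` (in `(ℤ/p^{m₀})ˣ`) form a subgroup `Λ₀ ≤ ℤⁿ` of index at most
`#(ℤ/p^{m₀}) = p^{m₀}` (it is the kernel of `x ↦ ∏ q̄ᵢ^{xᵢ} ∈ (ℤ/p^{m₀})ˣ`), and for `x ∈ Λ₀`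
with `ξ = ∏ qᵢ^{xᵢ} ≠ 1` one has `ord_p(ξ − 1) ≥ m₀`. [folklore] -/
theorem exists_principal_lattice {n p m₀ : ℕ} (hp : p.Prime) {q : Fin n → ℕ}
    (hq : ∀ i, (q i).Prime) (hqp : ∀ i, q i ≠ p) :
    ∃ Λ₀ : Submodule ℤ (Fin n → ℤ), Finite ((Fin n → ℤ) ⧸ Λ₀) ∧
      Nat.card ((Fin n → ℤ) ⧸ Λ₀) ≤ p ^ m₀ ∧
      ∀ x ∈ Λ₀, ∏ i, ((q i : ℚ)) ^ x i ≠ 1 →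
        (m₀ : ℤ) ≤ padicValRat p (∏ i, ((q i : ℚ)) ^ x i - 1) := by
  classical
  haveI : NeZero (p ^ m₀) := ⟨pow_ne_zero _ hp.ne_zero⟩
  have hcop : ∀ i, Nat.Coprime (q i) (p ^ m₀) := fun i =>
    Nat.Coprime.pow_right m₀ ((Nat.coprime_primes (hq i) hp).mpr (hqp i))
  let u : Fin n → (ZMod (p ^ m₀))ˣ := fun i => ZMod.unitOfCoprime (q i) (hcop i)
  have hu : ∀ i, ((u i : (ZMod (p ^ m₀))ˣ) : ZMod (p ^ m₀)) = (q i : ZMod (p ^ m₀)) :=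
    fun i => ZMod.coe_unitOfCoprime _ _
  -- the subgroup, as a `ℤ`-submodule of `ℤⁿ`
  let Λ₀ : Submodule ℤ (Fin n → ℤ) :=
    { carrier := {x | ∏ i, u i ^ x i = 1}
      add_mem' := by
        intro x y hx hy
        simp only [Set.mem_setOf_eq] at hx hy ⊢
        have : ∏ i, u i ^ (x + y) i = (∏ i, u i ^ x i) * ∏ i, u i ^ y i := by
          rw [← Finset.prod_mul_distrib]
          exact Finset.prod_congr rfl fun i _ => by rw [Pi.add_apply, zpow_add]
        rw [this, hx, hy, one_mul]
      zero_mem' := by simp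
      smul_mem' := by
        intro c x hx
        simp only [Set.mem_setOf_eq] at hx ⊢
        have : ∏ i, u i ^ (c • x) i = (∏ i, u i ^ x i) ^ c := by
          rw [← Finset.prod_zpow]
          exact Finset.prod_congr rfl fun i _ => by
            rw [Pi.smul_apply, smul_eq_mul, mul_comm, zpow_mul]
        rw [this, hx, one_zpow] }
  have hmem : ∀ x, x ∈ Λ₀ ↔ ∏ i, u i ^ x i = 1 := fun x => Iff.rfl
  -- the homomorphism `x ↦ ∏ ū_i^{x_i}` and its kernel
  let φ : (Fin n → ℤ) →+ Additive (ZMod (p ^ m₀))ˣ :=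
    AddMonoidHom.mk' (fun x => Additive.ofMul (∏ i, u i ^ x i)) (fun x y => by
      rw [← ofMul_mul, ← Finset.prod_mul_distrib]
      congr 1
      exact Finset.prod_congr rfl fun i _ => by rw [Pi.add_apply, zpow_add])
  have φ_apply : ∀ x, φ x = Additive.ofMul (∏ i, u i ^ x i) := fun x => rfl
  have hker : Λ₀.toAddSubgroup = φ.ker := by
    ext x
    rw [Submodule.mem_toAddSubgroup, hmem, AddMonoidHom.mem_ker, φ_apply]
    exact ⟨fun h => by rw [h]; rfl, fun h => ofMul_eq_zero.mp h⟩
  -- the index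
  have hidx : Λ₀.toAddSubgroup.index = Nat.card φ.range := by rw [hker, AddSubgroup.index_ker]
  have hrange : Nat.card φ.range ≤ p ^ m₀ := by
    calc Nat.card φ.range ≤ Nat.card (Additive (ZMod (p ^ m₀))ˣ) :=
          Finite.card_subtype_le _
      _ = Nat.card (ZMod (p ^ m₀))ˣ := rfl
      _ ≤ Nat.card (ZMod (p ^ m₀)) := Nat.card_le_card_of_injective _ Units.val_injective
      _ = p ^ m₀ := Nat.card_zmod _
  have hpos : 0 < Nat.card φ.range := Nat.card_pos
  have hquot : Nat.card ((Fin n → ℤ) ⧸ Λ₀) = Λ₀.toAddSubgroup.index := rfl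
  refine ⟨Λ₀, ?_, ?_, ?_⟩
  · apply Nat.finite_of_card_ne_zero
    rw [hquot, hidx]
    exact hpos.ne'
  · rw [hquot, hidx]; exact hrange
  · intro x hx hne
    exact le_padicValRat_of_prod_units_eq_one hp hq hqp u hu ((hmem x).mp hx) hne

/-! ### Arithmetic helpers: integer powers, valuations under powers, heights -/

/-- `a^{∑ f} = ∏ a^{f}` for a non-zero element of a field. [folklore] -/
theorem zpow_finset_sum_rat {ι : Type*} (s : Finset ι) {a : ℚ} (ha : a ≠ 0) (f : ι → ℤ) :
    a ^ (∑ i ∈ s, f i) = ∏ i ∈ s, a ^ f i := by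
  classical
  induction s using Finset.induction_on with
  | empty => simp
  | insert i s hi ih => rw [Finset.sum_insert hi, Finset.prod_insert hi, zpow_add₀ ha, ih]

/-- Exchange of products: `∏_k (∏_i a_i^{w_{k i}})^{c_k} = ∏_i a_i^{∑_k c_k w_{k i}}`. [folklore] -/
theorem prod_prod_zpow_zpow {n m : ℕ} (a : Fin n → ℚ) (ha : ∀ i, a i ≠ 0)
    (w : Fin m → Fin n → ℤ) (c : Fin m → ℤ) :
    ∏ k, (∏ i, a i ^ w k i) ^ c k = ∏ i, a i ^ (∑ k, c k * w k i) := by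
  calc ∏ k, (∏ i, a i ^ w k i) ^ c k = ∏ k, ∏ i, a i ^ (c k * w k i) := by
        refine Finset.prod_congr rfl fun k _ => ?_
        rw [← Finset.prod_zpow]
        refine Finset.prod_congr rfl fun i _ => ?_
        rw [← zpow_mul, mul_comm]
    _ = ∏ i, ∏ k, a i ^ (c k * w k i) := Finset.prod_comm
    _ = ∏ i, a i ^ (∑ k, c k * w k i) :=
        Finset.prod_congr rfl fun i _ => (zpow_finset_sum_rat _ (ha i) _).symm

/-- `ord_p(U/V − 1) = ord_p(U − V)` for natural numbers `U ≠ V` with `p ∤ V`. [folklore] -/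
theorem padicValRat_div_sub_one {p : ℕ} [Fact p.Prime] {U V : ℕ} (hV0 : V ≠ 0) (hpV : ¬ p ∣ V)
    (hUV : (U : ℤ) - V ≠ 0) :
    padicValRat p ((U : ℚ) / V - 1) = padicValInt p ((U : ℤ) - V) := by
  have hVQ : (V : ℚ) ≠ 0 := by exact_mod_cast hV0
  have h1 : (U : ℚ) / V - 1 = (((U : ℤ) - V : ℤ) : ℚ) / (V : ℚ) := by
    push_cast; field_simp
  rw [h1, padicValRat.div (by exact_mod_cast hUV) hVQ, padicValRat.of_int, padicValRat.of_nat,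
    padicValNat.eq_zero_of_not_dvd hpV]
  simp

/-- `ord_p(a) ≤ ord_p(b)` for integers `a ∣ b`, `b ≠ 0`. [folklore] -/
theorem padicValInt_le_of_dvd {p : ℕ} [Fact p.Prime] {a b : ℤ} (hab : a ∣ b) (hb : b ≠ 0) :
    padicValInt p a ≤ padicValInt p b := by
  have h := dvd_trans (padicValInt_dvd (p := p) a) hab
  rcases (padicValInt_dvd_iff _ _).mp h with h | h
  · exact absurd h hb
  · exact h

/-- **Valuations grow under powers**: for natural numbers `U ≠ V` prime to `p` (both positive) and
an integer `D ≠ 0`, `ord_p(U/V − 1) ≤ ord_p((U/V)^D − 1)` (`U − V ∣ U^d − V^d`). [folklore] -/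
theorem padicValRat_div_sub_one_le_zpow {p : ℕ} [Fact p.Prime] {U V : ℕ} (hU0 : U ≠ 0) (hV0 : V ≠ 0)
    (hpU : ¬ p ∣ U) (hpV : ¬ p ∣ V) (hUV : U ≠ V) {D : ℤ} (hD : D ≠ 0) :
    padicValRat p ((U : ℚ) / V - 1) ≤ padicValRat p (((U : ℚ) / V) ^ D - 1) := by
  have hp : p.Prime := Fact.out
  have hUVZ : (U : ℤ) - V ≠ 0 := by
    intro h; exact hUV (by exact_mod_cast (sub_eq_zero.mp h))
  rw [padicValRat_div_sub_one hV0 hpV hUVZ]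
  -- `D = ± d`, `d ≥ 1`
  set d : ℕ := D.natAbs with hd
  have hd1 : d ≠ 0 := Int.natAbs_ne_zero.mpr hD
  have hpUd : ¬ p ∣ U ^ d := fun h => hpU (hp.dvd_of_dvd_pow h)
  have hpVd : ¬ p ∣ V ^ d := fun h => hpV (hp.dvd_of_dvd_pow h)
  have hUVd : U ^ d ≠ V ^ d := fun h => hUV (Nat.pow_left_injective hd1 h)
  have hUVdZ : ((U ^ d : ℕ) : ℤ) - (V ^ d : ℕ) ≠ 0 := by
    intro h; exact hUVd (by exact_mod_cast (sub_eq_zero.mp h))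
  have hVUdZ : ((V ^ d : ℕ) : ℤ) - (U ^ d : ℕ) ≠ 0 := by
    intro h
    have h2 : V ^ d = U ^ d := by exact_mod_cast (sub_eq_zero.mp h)
    exact hUVd h2.symm
  have hdvd : (U : ℤ) - V ∣ ((U ^ d : ℕ) : ℤ) - (V ^ d : ℕ) := by
    push_cast; exact sub_dvd_pow_sub_pow _ _ _
  rcases Int.natAbs_eq D with hD' | hD'
  · -- `D = d`
    have hpow : ((U : ℚ) / V) ^ D - 1 = ((U ^ d : ℕ) : ℚ) / ((V ^ d : ℕ) : ℚ) - 1 := by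
      rw [hD', zpow_natCast, div_pow]; push_cast; ring
    rw [hpow, padicValRat_div_sub_one (pow_ne_zero d hV0) hpVd hUVdZ]
    exact_mod_cast padicValInt_le_of_dvd (p := p) hdvd hUVdZ
  · -- `D = -d`
    have hpow : ((U : ℚ) / V) ^ D - 1 = ((V ^ d : ℕ) : ℚ) / ((U ^ d : ℕ) : ℚ) - 1 := by
      rw [hD', zpow_neg, zpow_natCast, div_pow, inv_div]; push_cast; ring
    rw [hpow, padicValRat_div_sub_one (pow_ne_zero d hU0) hpUd hVUdZ]
    have hdvd' : (U : ℤ) - V ∣ ((V ^ d : ℕ) : ℤ) - (U ^ d : ℕ) := by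
      have : ((V ^ d : ℕ) : ℤ) - (U ^ d : ℕ) = -((((U ^ d : ℕ) : ℤ)) - (V ^ d : ℕ)) := by ring
      rw [this]; exact hdvd.neg_right
    exact_mod_cast padicValInt_le_of_dvd (p := p) hdvd' hVUdZ

/-- **Heights of prime-power products**: `h(∏ qᵢ^{xᵢ}) ≤ ‖x‖_∞ · log ∏ qᵢ` for positive integers
`qᵢ` (`h(∏ aᵢ) ≤ ∑ h(aᵢ)`, `h(a^k) = |k| h(a)`, `h(q) = log q`). [folklore] -/
theorem logHeight₁_prod_zpow_le {n : ℕ} (q : Fin n → ℕ) (hq : ∀ i, 1 ≤ q i) (x : Fin n → ℤ) :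
    logHeight₁ (∏ i, ((q i : ℚ)) ^ x i) ≤
      ‖fun i => (x i : ℝ)‖ * Real.log (((∏ i, q i : ℕ)) : ℝ) := by
  have hq0 : ∀ i, q i ≠ 0 := fun i => Nat.one_le_iff_ne_zero.mp (hq i)
  have hlogq : ∀ i, 0 ≤ Real.log (q i) := fun i =>
    Real.log_nonneg (by exact_mod_cast hq i)
  have hnorm : ∀ i, ((x i).natAbs : ℝ) ≤ ‖fun i => (x i : ℝ)‖ := by
    intro i
    have h1 : ((x i).natAbs : ℝ) = |(x i : ℝ)| := by
      rw [Nat.cast_natAbs, Int.cast_abs]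
    rw [h1, ← Real.norm_eq_abs]
    exact norm_le_pi_norm (fun i => (x i : ℝ)) i
  calc logHeight₁ (∏ i, ((q i : ℚ)) ^ x i) ≤ ∑ i, logHeight₁ (((q i : ℚ)) ^ x i) :=
        logHeight₁_prod_le _ _
    _ = ∑ i, ((x i).natAbs : ℝ) * Real.log (q i) := by
        refine Finset.sum_congr rfl fun i _ => ?_
        haveI : NeZero (q i) := ⟨hq0 i⟩
        rw [logHeight₁_zpow, Rat.logHeight₁_natCast]
    _ ≤ ∑ i, ‖fun i => (x i : ℝ)‖ * Real.log (q i) :=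
        Finset.sum_le_sum fun i _ => mul_le_mul_of_nonneg_right (hnorm i) (hlogq i)
    _ = ‖fun i => (x i : ℝ)‖ * ∑ i, Real.log (q i) := by rw [Finset.mul_sum]
    _ = ‖fun i => (x i : ℝ)‖ * Real.log (((∏ i, q i : ℕ)) : ℝ) := by
        rw [Nat.cast_prod, Real.log_prod]
        intro i _; exact_mod_cast hq0 i

open StewartTijdemanGeneric in
/-- **The principal-unit reduction of a prime family** (the algebraic core of Theorem D). Let `p`
be prime, `m₀ ∈ ℕ`, `q₁, …, qₙ ≠ p` distinct primes (`n ≥ 1`) and `e ∈ ℤⁿ ∖ {0}`. There are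
`1 ≤ k ≤ n`, positive rationals `β₁, …, β_k`, multiplicatively independent, with
`ord_p(βⱼ − 1) ≥ m₀`, non-zero integers `y₁, …, y_k` and `D ≠ 0` with
`∏ βⱼ^{yⱼ} = (∏ qᵢ^{eᵢ})^D`, `∏ max(1, h(βⱼ)) ≤ p^{m₀} (2 log ∏ qᵢ)ⁿ` and
`max |yⱼ| ≤ n · max|eᵢ| · n! · p^{m₀ n}`. Construction: short independent vectors `w₁, …, wₙ`
(`∏ ‖w_k‖_∞ ≤ p^{m₀}`, `exists_indep_prod_norm_le_card_quotient`) in the lattice of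
`exists_principal_lattice`, `β_k = ∏ qᵢ^{w_{k i}}`, `D = det(w)`, `y = e · adj(w)` (so
`∑ y_k w_k = D e`), and the subfamily of the `k` with `y_k ≠ 0`. [folklore] -/
theorem exists_principal_reduction {n p m₀ : ℕ} (hp : p.Prime) (hn : 0 < n) {q : Fin n → ℕ}
    (hq : ∀ i, (q i).Prime) (hinj : Function.Injective q) (hqp : ∀ i, q i ≠ p)
    {e : Fin n → ℤ} (he : e ≠ 0) :
    ∃ (k : ℕ) (β : Fin k → ℚ) (y : Fin k → ℤ) (D : ℤ), 1 ≤ k ∧ k ≤ n ∧ D ≠ 0 ∧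
      (∀ j, 0 < β j) ∧
      (∀ c : Fin k → ℤ, ∏ j, β j ^ c j = 1 → c = 0) ∧
      (∀ j, (m₀ : ℤ) ≤ padicValRat p (β j - 1)) ∧
      (∀ j, y j ≠ 0) ∧
      ∏ j, β j ^ y j = (∏ i, ((q i : ℚ)) ^ e i) ^ D ∧
      ∏ j, max 1 (logHeight₁ (β j)) ≤
        (p : ℝ) ^ m₀ * (2 * Real.log (((∏ i, q i : ℕ)) : ℝ)) ^ n ∧
      (((Finset.univ.sup fun j => (y j).natAbs : ℕ)) : ℝ) ≤
        n * ((Finset.univ.sup fun i => (e i).natAbs : ℕ) : ℝ) *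
          (n.factorial * ((p : ℝ) ^ m₀) ^ n) := by
  classical
  haveI := Fact.mk hp
  -- the lattice and the short generators
  obtain ⟨Λ₀, hfin, hcardle, hprinc⟩ := exists_principal_lattice (m₀ := m₀) hp hq hqp
  haveI := hfin
  obtain ⟨w, hwmem, hwli, hwprod⟩ := exists_indep_prod_norm_le_card_quotient hn Λ₀
  set N₀ : ℝ := (p : ℝ) ^ m₀ with hN₀
  have hp1 : (1 : ℝ) ≤ p := by exact_mod_cast hp.one_lt.le
  have hN₀1 : 1 ≤ N₀ := one_le_pow₀ hp1
  have hwprodN : ∏ k, ‖fun i => (w k i : ℝ)‖ ≤ N₀ :=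
    hwprod.trans (by rw [hN₀]; exact_mod_cast hcardle)
  -- norms: `w_k ≠ 0`, `1 ≤ ‖w_k‖ ≤ N₀`, `|w_k i| ≤ N₀`
  have hw0 : ∀ k, (fun i => (w k i : ℝ)) ≠ 0 := fun k => hwli.ne_zero k
  have hwk0 : ∀ k, w k ≠ 0 := fun k h => hw0 k (funext fun i => by simp [h])
  have hnorm1 : ∀ k, 1 ≤ ‖fun i => (w k i : ℝ)‖ := by
    intro k
    obtain ⟨i, hi⟩ : ∃ i, w k i ≠ 0 := by
      by_contra h
      push Not at h
      exact hwk0 k (funext fun i => h i)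
    calc (1 : ℝ) ≤ |(w k i : ℝ)| := by exact_mod_cast Int.one_le_abs hi
      _ = ‖(fun i => (w k i : ℝ)) i‖ := (Real.norm_eq_abs _).symm
      _ ≤ ‖fun i => (w k i : ℝ)‖ := norm_le_pi_norm (fun i => (w k i : ℝ)) i
  have hnormle : ∀ k, ‖fun i => (w k i : ℝ)‖ ≤ N₀ := by
    intro k
    have h1 : (1 : ℝ) ≤ ∏ k' ∈ univ.erase k, ‖fun i => (w k' i : ℝ)‖ := by
      have := Finset.prod_le_prod (s := univ.erase k) (f := fun _ => (1 : ℝ))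
        (g := fun k' => ‖fun i => (w k' i : ℝ)‖) (fun _ _ => zero_le_one) (fun k' _ => hnorm1 k')
      simpa using this
    calc ‖fun i => (w k i : ℝ)‖
        ≤ ‖fun i => (w k i : ℝ)‖ * ∏ k' ∈ univ.erase k, ‖fun i => (w k' i : ℝ)‖ :=
          le_mul_of_one_le_right (norm_nonneg _) h1
      _ = ∏ k', ‖fun i => (w k' i : ℝ)‖ :=
          Finset.mul_prod_erase (univ : Finset (Fin n)) (fun k' => ‖fun i => (w k' i : ℝ)‖)
            (mem_univ k)
      _ ≤ N₀ := hwprodN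
  have hentry : ∀ k i, |(w k i : ℝ)| ≤ N₀ := fun k i =>
    le_trans (by rw [← Real.norm_eq_abs]; exact norm_le_pi_norm (fun i => (w k i : ℝ)) i)
      (hnormle k)
  have hentryZ : ∀ k i, |w k i| ≤ (p : ℤ) ^ m₀ := fun k i => by
    have := hentry k i
    rw [hN₀] at this
    exact_mod_cast this
  -- the matrix `W` (rows `w_k`), `D = det W ≠ 0`
  set W : Matrix (Fin n) (Fin n) ℤ := Matrix.of fun k i => w k i with hW
  have hWmap : W.map (Int.cast : ℤ → ℝ) = Matrix.of fun k i => (w k i : ℝ) := by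
    ext k i; simp [hW]
  have hD : W.det ≠ 0 := by
    have hli' : LinearIndependent ℝ (fun k => (W.map (Int.cast : ℤ → ℝ)) k) := by
      rw [hWmap]; exact hwli
    have hu : IsUnit (W.map (Int.cast : ℤ → ℝ)) :=
      Matrix.linearIndependent_rows_iff_isUnit.mp hli'
    have hdet : (W.map (Int.cast : ℤ → ℝ)).det ≠ 0 :=
      ((Matrix.isUnit_iff_isUnit_det _).mp hu).ne_zero
    intro h0
    apply hdet
    have : (W.map (Int.cast : ℤ → ℝ)).det = ((W.det : ℤ) : ℝ) := by norm_cast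
    rw [this, h0, Int.cast_zero]
  -- `y = e · adj W`, `∑_k y_k w_k = D e`
  set y : Fin n → ℤ := Matrix.vecMul e W.adjugate with hy
  have hyW : Matrix.vecMul y W = W.det • e := by
    rw [hy, Matrix.vecMul_vecMul, Matrix.adjugate_mul, Matrix.vecMul_smul, Matrix.vecMul_one]
  have hsum_y : ∀ i, ∑ k, y k * w k i = W.det * e i := by
    intro i
    have := congr_fun hyW i
    simpa [Matrix.vecMul, dotProduct, hW] using this
  have hy_apply : ∀ k, y k = ∑ i, e i * W.adjugate i k := by
    intro k; simp [hy, Matrix.vecMul, dotProduct]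
  -- `y ≠ 0`
  obtain ⟨i₀, hi₀⟩ : ∃ i, e i ≠ 0 := by
    by_contra h
    push Not at h
    exact he (funext h)
  have hy0 : ∃ k, y k ≠ 0 := by
    by_contra h
    push Not at h
    have := hsum_y i₀
    simp only [h, zero_mul, Finset.sum_const_zero] at this
    exact mul_ne_zero hD hi₀ this.symm
  -- bounds for `y`
  set Bn : ℕ := Finset.univ.sup fun i => (e i).natAbs with hBn
  have hBi : ∀ i, |e i| ≤ (Bn : ℤ) := fun i => by
    have h1 : (e i).natAbs ≤ Bn := Finset.le_sup (f := fun i => (e i).natAbs) (mem_univ i)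
    rw [← Int.natCast_natAbs]
    exact_mod_cast h1
  have hpZ1 : (1 : ℤ) ≤ (p : ℤ) ^ m₀ := one_le_pow₀ (by exact_mod_cast hp.one_lt.le)
  have hadj : ∀ i k, |W.adjugate i k| ≤ (n.factorial : ℤ) * ((p : ℤ) ^ m₀) ^ n := by
    intro i k
    rw [Matrix.adjugate_apply]
    have h := Matrix.det_le (A := W.updateRow k (Pi.single i 1)) (abv := AbsoluteValue.abs)
      (x := ((p : ℤ) ^ m₀)) (fun k' j => ?_)
    · simpa [Fintype.card_fin, nsmul_eq_mul] using h
    · rw [AbsoluteValue.abs_apply, Matrix.updateRow_apply]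
      split_ifs with hk
      · have : |(Pi.single i (1 : ℤ) : Fin n → ℤ) j| ≤ 1 := by
          rw [Pi.single_apply]; split_ifs <;> simp
        exact this.trans hpZ1
      · simp only [hW, Matrix.of_apply]
        exact hentryZ k' j
  have hyk : ∀ k, |y k| ≤ (n : ℤ) * Bn * (n.factorial * ((p : ℤ) ^ m₀) ^ n) := by
    intro k
    rw [hy_apply]
    calc |∑ i, e i * W.adjugate i k| ≤ ∑ i, |e i * W.adjugate i k| :=
          Finset.abs_sum_le_sum_abs _ _
      _ ≤ ∑ i, (Bn : ℤ) * (n.factorial * ((p : ℤ) ^ m₀) ^ n) :=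
          Finset.sum_le_sum fun i _ => by
            rw [abs_mul]
            exact mul_le_mul (hBi i) (hadj i k) (abs_nonneg _) (by positivity)
      _ = (n : ℤ) * Bn * (n.factorial * ((p : ℤ) ^ m₀) ^ n) := by
          rw [Finset.sum_const, Finset.card_univ, Fintype.card_fin, nsmul_eq_mul]; ring
  -- the numbers `β_k = ∏ q_i^{w_k i}`
  set β : Fin n → ℚ := fun k => ∏ i, ((q i : ℚ)) ^ w k i with hβ
  have hq0 : ∀ i, (q i : ℚ) ≠ 0 := fun i => by exact_mod_cast (hq i).ne_zero
  have hβpos : ∀ k, 0 < β k := fun k =>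
    Finset.prod_pos fun i _ => zpow_pos (by exact_mod_cast (hq i).pos) _
  have hβne1 : ∀ k, β k ≠ 1 := fun k h => hwk0 k (prime_family_zpow_eq_one hq hinj h)
  have hβprinc : ∀ k, (m₀ : ℤ) ≤ padicValRat p (β k - 1) := fun k =>
    hprinc (w k) (hwmem k) (hβne1 k)
  have hβind : ∀ c : Fin n → ℤ, ∏ k, β k ^ c k = 1 → c = 0 := by
    intro c hc
    have hre : ∏ k, β k ^ c k = ∏ i, ((q i : ℚ)) ^ (∑ k, c k * w k i) :=
      prod_prod_zpow_zpow _ hq0 w c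
    rw [hre] at hc
    have hzero := prime_family_zpow_eq_one hq hinj hc
    have hlin : ∑ k, (c k : ℝ) • (fun i => (w k i : ℝ)) = 0 := by
      funext i
      have := congr_fun hzero i
      simp only [Finset.sum_apply, Pi.smul_apply, smul_eq_mul, Pi.zero_apply] at this ⊢
      exact_mod_cast this
    have := Fintype.linearIndependent_iff.mp hwli (fun k => (c k : ℝ)) hlin
    funext k
    exact_mod_cast this k
  -- heights of the `β_k`
  set R' : ℝ := (((∏ i, q i : ℕ)) : ℝ) with hR'
  have hR'2 : (2 : ℝ) ≤ R' := by
    rw [hR']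
    have h2 : 2 ≤ ∏ i, q i := by
      obtain ⟨i₁⟩ : Nonempty (Fin n) := ⟨⟨0, hn⟩⟩
      calc 2 ≤ q i₁ := (hq i₁).two_le
        _ ≤ ∏ i, q i := Nat.le_of_dvd (Finset.prod_pos fun i _ => (hq i).pos)
            (Finset.dvd_prod_of_mem _ (mem_univ i₁))
    exact_mod_cast h2
  have hlogR' : Real.log 2 ≤ Real.log R' := Real.log_le_log (by norm_num) hR'2
  have hl2 : (0.6931471803 : ℝ) < Real.log 2 := Real.log_two_gt_d9
  have hmax_each : ∀ k, max 1 (logHeight₁ (β k)) ≤ ‖fun i => (w k i : ℝ)‖ * (2 * Real.log R') := by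
    intro k
    have hh : logHeight₁ (β k) ≤ ‖fun i => (w k i : ℝ)‖ * Real.log R' :=
      logHeight₁_prod_zpow_le q (fun i => (hq i).one_lt.le) (w k)
    refine max_le ?_ ?_
    · nlinarith [hnorm1 k, hlogR', hl2]
    · nlinarith [hnorm1 k, hlogR', hl2, norm_nonneg (fun i => (w k i : ℝ))]
  have hheights : ∏ k, max 1 (logHeight₁ (β k)) ≤ N₀ * (2 * Real.log R') ^ n := by
    calc ∏ k, max 1 (logHeight₁ (β k)) ≤ ∏ k, (‖fun i => (w k i : ℝ)‖ * (2 * Real.log R')) :=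
          Finset.prod_le_prod (fun k _ => le_trans zero_le_one (le_max_left _ _)) fun k _ =>
            hmax_each k
      _ = (∏ k, ‖fun i => (w k i : ℝ)‖) * (2 * Real.log R') ^ n := by
          rw [Finset.prod_mul_distrib, Finset.prod_const, Finset.card_univ, Fintype.card_fin]
      _ ≤ N₀ * (2 * Real.log R') ^ n :=
          mul_le_mul_of_nonneg_right hwprodN (pow_nonneg (by nlinarith) n)
  -- the subfamily `J = {k : y_k ≠ 0}`
  set J : Finset (Fin n) := univ.filter fun k => y k ≠ 0 with hJ
  have hJne : J.Nonempty := by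
    obtain ⟨k, hk⟩ := hy0
    exact ⟨k, mem_filter.mpr ⟨mem_univ k, hk⟩⟩
  set kJ : ℕ := J.card with hkJ
  have hkJ1 : 1 ≤ kJ := Finset.card_pos.mpr hJne
  have hkJn : kJ ≤ n := by
    rw [hkJ]
    exact (Finset.card_le_univ J).trans (by rw [Fintype.card_fin])
  let ψ : Fin kJ ≃ J := J.equivFin.symm
  set β' : Fin kJ → ℚ := fun j => β (ψ j) with hβ'
  set y' : Fin kJ → ℤ := fun j => y (ψ j) with hy'
  have hyJ : ∀ j, y' j ≠ 0 := fun j => (mem_filter.mp (ψ j).2).2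
  refine ⟨kJ, β', y', W.det, hkJ1, hkJn, hD, fun j => hβpos _, ?_, fun j => hβprinc _, hyJ,
    ?_, ?_, ?_⟩
  · -- multiplicative independence of the subfamily
    intro c hc
    set ct : Fin n → ℤ := fun k => if h : k ∈ J then c (ψ.symm ⟨k, h⟩) else 0 with hct
    have hprodJ : ∏ k, β k ^ ct k = ∏ j, β' j ^ c j := by
      rw [← Finset.prod_subset (Finset.subset_univ J) (fun k _ hk => by simp [hct, hk])]
      rw [← Finset.prod_coe_sort J]
      refine Fintype.prod_equiv ψ.symm _ _ fun k => ?_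
      simp only [hβ', hct, dif_pos k.2, Equiv.apply_symm_apply]
    have hct0 := hβind ct (hprodJ.trans hc)
    funext j
    have := congr_fun hct0 (ψ j)
    simp only [hct, dif_pos (ψ j).2, Pi.zero_apply] at this
    simpa using this
  · -- the product `∏ β'^{y'} = (∏ q^e)^D`
    have h1 : ∏ j, β' j ^ y' j = ∏ k ∈ J, β k ^ y k := by
      rw [← Finset.prod_coe_sort J]
      exact Fintype.prod_equiv ψ _ _ fun j => rfl
    have h2 : ∏ k ∈ J, β k ^ y k = ∏ k, β k ^ y k := by
      apply Finset.prod_subset (Finset.subset_univ J)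
      intro k _ hk
      have : y k = 0 := by simpa [hJ] using hk
      rw [this, zpow_zero]
    rw [h1, h2, prod_prod_zpow_zpow _ hq0 w y, ← Finset.prod_zpow]
    refine Finset.prod_congr rfl fun i _ => ?_
    rw [hsum_y i, mul_comm, zpow_mul]
  · -- heights of the subfamily
    have h1 : ∏ j, max 1 (logHeight₁ (β' j)) = ∏ k ∈ J, max 1 (logHeight₁ (β k)) := by
      rw [← Finset.prod_coe_sort J]
      exact Fintype.prod_equiv ψ _ _ fun j => rfl
    have h2 : ∏ k ∈ J, max 1 (logHeight₁ (β k)) ≤ ∏ k, max 1 (logHeight₁ (β k)) := by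
      rw [← Finset.prod_mul_prod_compl J (fun k => max 1 (logHeight₁ (β k)))]
      have hc : (1 : ℝ) ≤ ∏ k ∈ Jᶜ, max 1 (logHeight₁ (β k)) := by
        have := Finset.prod_le_prod (s := Jᶜ) (f := fun _ => (1 : ℝ))
          (g := fun k => max 1 (logHeight₁ (β k))) (fun _ _ => zero_le_one)
          (fun k _ => le_max_left _ _)
        simpa using this
      exact le_mul_of_one_le_right (Finset.prod_nonneg fun k _ =>
        le_trans zero_le_one (le_max_left _ _)) hc
    rw [h1]
    exact h2.trans hheights
  · -- the exponents of the subfamily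
    have hne : (univ : Finset (Fin kJ)).Nonempty := Finset.univ_nonempty_iff.mpr ⟨⟨0, hkJ1⟩⟩
    obtain ⟨j, -, hj⟩ := Finset.exists_mem_eq_sup univ hne (fun j => (y' j).natAbs)
    rw [hj]
    have h1 : (((y' j).natAbs : ℕ) : ℝ) = (((|y (ψ j)| : ℤ)) : ℝ) := by
      rw [Nat.cast_natAbs]
    rw [h1]
    have h2 := hyk (ψ j)
    have h3 : (((|y (ψ j)| : ℤ)) : ℝ) ≤ (((n : ℤ) * Bn * (n.factorial * ((p : ℤ) ^ m₀) ^ n) : ℤ) : ℝ) := by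
      exact_mod_cast h2
    refine h3.trans (le_of_eq ?_)
    push_cast
    ring

/-- `p ∤ ∏ qᵢ^{fᵢ}` for primes `qᵢ ≠ p`. [folklore] -/
theorem not_dvd_prod_prime_pow {n p : ℕ} (hp : p.Prime) {q : Fin n → ℕ} (hq : ∀ i, (q i).Prime)
    (hqp : ∀ i, q i ≠ p) (f : Fin n → ℕ) : ¬ p ∣ ∏ i, q i ^ f i := by
  intro h
  have hp' : _root_.Prime p := Nat.prime_iff.mp hp
  obtain ⟨i, -, hi⟩ := (hp'.dvd_finsetProd_iff _).mp h
  have h1 : p ∣ q i := hp.dvd_of_dvd_pow hi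
  exact hqp i ((Nat.prime_dvd_prime_iff_eq hp (hq i)).mp h1).symm

/-- `log(n · n!) ≤ n²` for `n ≥ 1` (`n! ≤ nⁿ`, `log n ≤ n − 1`). [folklore] -/
theorem log_mul_factorial_le_sq {n : ℕ} (hn : 1 ≤ n) :
    Real.log ((n : ℝ) * n.factorial) ≤ (n : ℝ) ^ 2 := by
  have hn' : (1 : ℝ) ≤ n := by exact_mod_cast hn
  have hfact : (n.factorial : ℝ) ≤ (n : ℝ) ^ n := by exact_mod_cast Nat.factorial_le_pow n
  have h1 : (n : ℝ) * n.factorial ≤ (n : ℝ) ^ (n + 1) := by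
    rw [pow_succ']; exact mul_le_mul_of_nonneg_left hfact (by linarith)
  have hlogn : Real.log n ≤ (n : ℝ) - 1 := Real.log_le_sub_one_of_pos (by linarith)
  have hlogn0 : 0 ≤ Real.log n := Real.log_nonneg hn'
  calc Real.log ((n : ℝ) * n.factorial) ≤ Real.log ((n : ℝ) ^ (n + 1)) :=
        Real.log_le_log (by positivity) h1
    _ = ((n : ℝ) + 1) * Real.log n := by rw [Real.log_pow]; push_cast; ring
    _ ≤ ((n : ℝ) + 1) * ((n : ℝ) - 1) := mul_le_mul_of_nonneg_left hlogn (by linarith)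
    _ ≤ (n : ℝ) ^ 2 := by nlinarith

/-- The elementary inequality behind the exponent book-keeping of
`primeFamilyBound_of_principalUnitBound`: for `N, M, L₃ ≥ 1`, `L_p > 0`, `Y ≥ 1`,
`N² + N M L_p + Y ≤ 2 N² M (L₃ + L_p) Y`. [folklore] -/
theorem sq_add_add_le_two_mul {N M L₃ Lp Y : ℝ} (hN : 1 ≤ N) (hM : 1 ≤ M) (hL₃ : 1 ≤ L₃)
    (hLp : 0 < Lp) (hY : 1 ≤ Y) :
    N ^ 2 + N * (M * Lp) + Y ≤ 2 * N ^ 2 * M * (L₃ + Lp) * Y := by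
  have hN2 : 1 ≤ N ^ 2 := by nlinarith
  have h1 : N ^ 2 ≤ N ^ 2 * Y := le_mul_of_one_le_right (by positivity) hY
  have h2 : Y ≤ N ^ 2 * Y := le_mul_of_one_le_left (by linarith) hN2
  have hML : 1 ≤ M * L₃ := one_le_mul_of_one_le_of_one_le hM hL₃
  have h3 : N ^ 2 * Y ≤ N ^ 2 * Y * (M * L₃) := le_mul_of_one_le_right (by positivity) hML
  have h4 : N * (M * Lp) ≤ N ^ 2 * (M * Lp) :=
    mul_le_mul_of_nonneg_right (by nlinarith) (by positivity)
  have h5 : N ^ 2 * (M * Lp) ≤ N ^ 2 * (M * Lp) * Y := le_mul_of_one_le_right (by positivity) hY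
  have h6 : 0 ≤ N ^ 2 * (M * Lp) * Y := by positivity
  have hexp : 2 * N ^ 2 * M * (L₃ + Lp) * Y =
      2 * (N ^ 2 * Y * (M * L₃)) + 2 * (N ^ 2 * (M * Lp) * Y) := by ring
  rw [hexp]
  linarith

open StewartTijdemanGeneric in
/-- **The `p`-adic bound for prime families from a bound for principal units** (the reduction
behind Theorem D). Hypothesis `hPU`: for every prime `p`, every `k ≥ 1`, all multiplicatively
independent positive rationals `β₁, …, β_k` with `ord_p(βⱼ − 1) ≥ m₀` (principal units of level
`m₀`) and all `y ∈ (ℤ ∖ {0})^k`,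
`ord_p(∏ βⱼ^{yⱼ} − 1) ≤ K L^k k^{κk} p^σ (∏ max(1, h(βⱼ))) (log max(3, max|yⱼ|))^τ`.
Conclusion: for distinct primes `q₁, …, qₙ ≠ p` and `e ∈ ℤⁿ ∖ {0}`,
`ord_p(∏ qᵢ^{eᵢ} − 1) ≤ K (2m₀)^τ (2L)ⁿ n^{κn} n^{2τ} (log ∏ qᵢ)ⁿ · p^{σ+m₀} (log 3p)^τ ·
(log max(3, max|eᵢ|))^τ`. Proof: `exists_principal_reduction` (`∏ βⱼ^{yⱼ} = u^D`,
`u = ∏ qᵢ^{eᵢ}`), `ord_p(u − 1) ≤ ord_p(u^D − 1)` (`padicValRat_div_sub_one_le_zpow`), and the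
book-keeping `∏ max(1, h(βⱼ)) ≤ p^{m₀} (2 log ∏ qᵢ)ⁿ`,
`log max(3, max|yⱼ|) ≤ 2 n² m₀ log(3p) log max(3, max|eᵢ|)`. [folklore] -/
theorem primeFamilyBound_of_principalUnitBound {K L κ σ : ℝ} {τ m₀ : ℕ}
    (hK : 0 ≤ K) (hL : 1 ≤ L) (hκ0 : 0 ≤ κ) (hm : 1 ≤ m₀)
    (hPU : ∀ (p k : ℕ) (β : Fin k → ℚ) (y : Fin k → ℤ), p.Prime → 1 ≤ k →
      (∀ j, 0 < β j) →
      (∀ c : Fin k → ℤ, ∏ j, β j ^ c j = 1 → c = 0) →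
      (∀ j, (m₀ : ℤ) ≤ padicValRat p (β j - 1)) →
      (∀ j, y j ≠ 0) →
      (padicValRat p (∏ j, β j ^ y j - 1) : ℝ) ≤
        K * L ^ k * (k : ℝ) ^ (κ * k) * (p : ℝ) ^ σ * (∏ j, max 1 (logHeight₁ (β j))) *
          Real.log (max 3 ((Finset.univ.sup fun j => (y j).natAbs : ℕ) : ℝ)) ^ τ)
    (p n : ℕ) (q : Fin n → ℕ) (e : Fin n → ℤ) (hp : p.Prime)
    (hq : ∀ i, (q i).Prime) (hinj : Function.Injective q) (hqp : ∀ i, q i ≠ p) (he : e ≠ 0)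
    (hne : ∏ i, ((q i : ℚ)) ^ e i ≠ 1) :
    (padicValRat p (∏ i, ((q i : ℚ)) ^ e i - 1) : ℝ) ≤
      K * (2 * (m₀ : ℝ)) ^ τ * (2 * L) ^ n * (n : ℝ) ^ (κ * n) * (n : ℝ) ^ (2 * τ) *
          Real.log (((∏ i, q i : ℕ)) : ℝ) ^ n *
        ((p : ℝ) ^ (σ + m₀) * Real.log (3 * p) ^ τ) *
        Real.log (max 3 ((Finset.univ.sup fun i => (e i).natAbs : ℕ) : ℝ)) ^ τ := by
  classical
  haveI := Fact.mk hp
  -- `n ≥ 1`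
  have hn : 0 < n := by
    rcases Nat.eq_zero_or_pos n with h0 | h0
    · subst h0; exact absurd (funext fun i => Fin.elim0 i) he
    · exact h0
  have hn1 : (1 : ℝ) ≤ n := by exact_mod_cast hn
  obtain ⟨k, β, y, D, hk1, hkn, hD, hβpos, hβind, hβprinc, hy, hprod, hheights, hY⟩ :=
    exists_principal_reduction (m₀ := m₀) hp hn hq hinj hqp he
  -- the valuation of `u − 1` is at most that of `u^D − 1 = ∏ β^y − 1`
  set u : ℚ := ∏ i, ((q i : ℚ)) ^ e i with hu
  have hq0 : ∀ i, q i ≠ 0 := fun i => (hq i).ne_zero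
  set U : ℕ := ∏ i, q i ^ (e i).toNat with hU
  set V : ℕ := ∏ i, q i ^ (-e i).toNat with hV
  have hU0 : U ≠ 0 := Finset.prod_ne_zero_iff.mpr fun i _ => pow_ne_zero _ (hq0 i)
  have hV0 : V ≠ 0 := Finset.prod_ne_zero_iff.mpr fun i _ => pow_ne_zero _ (hq0 i)
  have hpU : ¬ p ∣ U := not_dvd_prod_prime_pow hp hq hqp _
  have hpV : ¬ p ∣ V := not_dvd_prod_prime_pow hp hq hqp _
  have huUV : u = (U : ℚ) / V := prod_zpow_eq_div q hq0 e
  have hUV : U ≠ V := by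
    intro h
    apply hne
    rw [huUV, h, div_self (by exact_mod_cast hV0)]
  have hval : padicValRat p (u - 1) ≤ padicValRat p (∏ j, β j ^ y j - 1) := by
    rw [hprod, huUV]
    exact padicValRat_div_sub_one_le_zpow hU0 hV0 hpU hpV hUV hD
  have hval' : (padicValRat p (u - 1) : ℝ) ≤ (padicValRat p (∏ j, β j ^ y j - 1) : ℝ) := by
    exact_mod_cast hval
  -- the principal-unit bound
  have key := hPU p k β y hp hk1 hβpos hβind hβprinc hy
  -- abbreviations
  set R' : ℝ := (((∏ i, q i : ℕ)) : ℝ) with hR'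
  set N₀ : ℝ := (p : ℝ) ^ m₀ with hN₀
  set Yb : ℝ := Real.log (max 3 ((Finset.univ.sup fun i => (e i).natAbs : ℕ) : ℝ)) with hYb
  set Yk : ℝ := Real.log (max 3 ((Finset.univ.sup fun j => (y j).natAbs : ℕ) : ℝ)) with hYk
  have hp1 : (1 : ℝ) ≤ p := by exact_mod_cast hp.one_lt.le
  have hp0 : (0 : ℝ) < p := by linarith
  have hN₀1 : 1 ≤ N₀ := one_le_pow₀ hp1
  have hR'2 : (2 : ℝ) ≤ R' := by
    rw [hR']
    have h2 : 2 ≤ ∏ i, q i := by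
      obtain ⟨i₁⟩ : Nonempty (Fin n) := ⟨⟨0, hn⟩⟩
      calc 2 ≤ q i₁ := (hq i₁).two_le
        _ ≤ ∏ i, q i := Nat.le_of_dvd (Finset.prod_pos fun i _ => (hq i).pos)
            (Finset.dvd_prod_of_mem _ (mem_univ i₁))
    exact_mod_cast h2
  have hlogR'0 : 0 ≤ Real.log R' := Real.log_nonneg (by linarith)
  have hl3 : (1 : ℝ) ≤ Real.log 3 := by
    rw [Real.le_log_iff_exp_le (by norm_num)]
    exact Real.exp_one_lt_d9.le.trans (by norm_num)
  have hYb1 : 1 ≤ Yb := hl3.trans (Real.log_le_log (by norm_num) (le_max_left _ _))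
  have hYk0 : 0 ≤ Yk := Real.log_nonneg (le_trans (by norm_num) (le_max_left _ _))
  have hlogp : Real.log 2 ≤ Real.log p := Real.log_le_log (by norm_num) (by exact_mod_cast hp.two_le)
  have hl2 : (0.6931471803 : ℝ) < Real.log 2 := Real.log_two_gt_d9
  have hlog3p : Real.log (3 * p) = Real.log 3 + Real.log p := Real.log_mul (by norm_num) hp0.ne'
  have hm1 : (1 : ℝ) ≤ m₀ := by exact_mod_cast hm
  -- (A) the constants in `k` against those in `n`
  have hkn' : (k : ℝ) ≤ n := by exact_mod_cast hkn
  have hk1' : (1 : ℝ) ≤ k := by exact_mod_cast hk1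
  have hA : K * L ^ k * (k : ℝ) ^ (κ * k) * (p : ℝ) ^ σ ≤ K * L ^ n * (n : ℝ) ^ (κ * n) * (p : ℝ) ^ σ := by
    have h1 : L ^ k ≤ L ^ n := pow_le_pow_right₀ hL hkn
    have h2 : (k : ℝ) ^ (κ * k) ≤ (n : ℝ) ^ (κ * n) :=
      calc (k : ℝ) ^ (κ * k) ≤ (n : ℝ) ^ (κ * k) :=
            Real.rpow_le_rpow (by linarith) hkn' (by positivity)
        _ ≤ (n : ℝ) ^ (κ * n) :=
            Real.rpow_le_rpow_of_exponent_le hn1 (by nlinarith)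
    have hL0 : 0 ≤ L := by linarith
    apply mul_le_mul_of_nonneg_right _ (by positivity)
    exact mul_le_mul (mul_le_mul_of_nonneg_left h1 hK) h2 (by positivity) (by positivity)
  -- (C) the exponents: `log max(3, max|y_j|) ≤ 2 n² m₀ log(3p) log max(3, max|e_i|)`
  have hC : Yk ≤ 2 * (n : ℝ) ^ 2 * m₀ * Real.log (3 * p) * Yb := by
    set Bn : ℕ := Finset.univ.sup fun i => (e i).natAbs with hBn
    set M₁ : ℝ := (n : ℝ) * n.factorial * N₀ ^ n with hM₁
    have hM₁1 : 1 ≤ M₁ := by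
      have h1 : (1 : ℝ) ≤ n.factorial := by exact_mod_cast Nat.factorial_pos n
      have h2 : (1 : ℝ) ≤ N₀ ^ n := one_le_pow₀ hN₀1
      calc (1 : ℝ) = 1 * 1 * 1 := by ring
        _ ≤ (n : ℝ) * n.factorial * N₀ ^ n := by
            apply mul_le_mul (mul_le_mul hn1 h1 zero_le_one (by linarith)) h2 zero_le_one
            positivity
    have hmax : (max 3 ((Finset.univ.sup fun j => (y j).natAbs : ℕ) : ℝ)) ≤ M₁ * max 3 (Bn : ℝ) := by
      refine max_le ?_ ?_
      · calc (3 : ℝ) = 1 * 3 := by ring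
          _ ≤ M₁ * max 3 (Bn : ℝ) := mul_le_mul hM₁1 (le_max_left _ _) (by norm_num) (by linarith)
      · calc (((Finset.univ.sup fun j => (y j).natAbs : ℕ)) : ℝ)
            ≤ n * (Bn : ℝ) * (n.factorial * N₀ ^ n) := hY
          _ = M₁ * Bn := by rw [hM₁]; ring
          _ ≤ M₁ * max 3 (Bn : ℝ) := mul_le_mul_of_nonneg_left (le_max_right _ _) (by linarith)
    have hlogM : Real.log M₁ ≤ (n : ℝ) ^ 2 + n * (m₀ * Real.log p) := by
      rw [hM₁, Real.log_mul (by positivity) (by positivity), hN₀, ← pow_mul, Real.log_pow]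
      have := log_mul_factorial_le_sq hn
      push_cast
      nlinarith
    have h3 : (0 : ℝ) < max 3 (Bn : ℝ) := lt_of_lt_of_le (by norm_num) (le_max_left _ _)
    calc Yk ≤ Real.log (M₁ * max 3 (Bn : ℝ)) :=
          Real.log_le_log (lt_of_lt_of_le (by norm_num) (le_max_left _ _)) hmax
      _ = Real.log M₁ + Yb := by rw [Real.log_mul (by linarith) h3.ne', hYb]
      _ ≤ (n : ℝ) ^ 2 + n * (m₀ * Real.log p) + Yb := by linarith
      _ ≤ 2 * (n : ℝ) ^ 2 * m₀ * Real.log (3 * p) * Yb := by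
          rw [hlog3p]
          exact sq_add_add_le_two_mul hn1 hm1 hl3 (by linarith) hYb1
  have hCτ : Yk ^ τ ≤ (2 * (n : ℝ) ^ 2 * m₀ * Real.log (3 * p) * Yb) ^ τ :=
    pow_le_pow_left₀ hYk0 hC τ
  -- assembling
  have hB0 : 0 ≤ ∏ j, max 1 (logHeight₁ (β j)) :=
    Finset.prod_nonneg fun j _ => le_trans zero_le_one (le_max_left _ _)
  have hA0 : 0 ≤ K * L ^ n * (n : ℝ) ^ (κ * n) * (p : ℝ) ^ σ := by
    have : 0 ≤ L := by linarith
    positivity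
  have hstep : K * L ^ k * (k : ℝ) ^ (κ * k) * (p : ℝ) ^ σ * (∏ j, max 1 (logHeight₁ (β j))) * Yk ^ τ ≤
      K * L ^ n * (n : ℝ) ^ (κ * n) * (p : ℝ) ^ σ * (N₀ * (2 * Real.log R') ^ n) *
        (2 * (n : ℝ) ^ 2 * m₀ * Real.log (3 * p) * Yb) ^ τ := by
    apply mul_le_mul _ hCτ (pow_nonneg hYk0 τ) (by positivity)
    exact mul_le_mul hA hheights hB0 hA0
  have hpow : (p : ℝ) ^ (σ + m₀) = (p : ℝ) ^ σ * N₀ := by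
    rw [Real.rpow_add hp0, Real.rpow_natCast]
  calc (padicValRat p (u - 1) : ℝ) ≤ (padicValRat p (∏ j, β j ^ y j - 1) : ℝ) := hval'
    _ ≤ K * L ^ k * (k : ℝ) ^ (κ * k) * (p : ℝ) ^ σ * (∏ j, max 1 (logHeight₁ (β j))) * Yk ^ τ := key
    _ ≤ K * L ^ n * (n : ℝ) ^ (κ * n) * (p : ℝ) ^ σ * (N₀ * (2 * Real.log R') ^ n) *
        (2 * (n : ℝ) ^ 2 * m₀ * Real.log (3 * p) * Yb) ^ τ := hstep
    _ = K * (2 * (m₀ : ℝ)) ^ τ * (2 * L) ^ n * (n : ℝ) ^ (κ * n) * (n : ℝ) ^ (2 * τ) *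
          Real.log R' ^ n * ((p : ℝ) ^ (σ + m₀) * Real.log (3 * p) ^ τ) * Yb ^ τ := by
        rw [hpow]; ring

/-! ### The Stewart–Tijdeman summation with an abstract class function -/

open StewartTijdemanGeneric in
/-- **The Stewart–Tijdeman summation, abstract form** (`sum_padicPart_le` of the sibling file with
the class bound `K Lⁿ n^{κn} p^σ ∏ log qᵢ` replaced by `F(n, ∏ qᵢ) · G(p)` for arbitrary
non-negative `F, G`). Let `y ≠ z` be coprime positive integers, `S` the set of primes of `yz`
(`n = #S`), `x` a positive integer coprime to `yz` with `x ∣ y² − z²`. If for every prime `p ≥ p₀`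
and every family of distinct primes `q₁, …, qₙ ≠ p` with exponents `e ≠ 0`,
`ord_p(q₁^{e₁}⋯qₙ^{eₙ} − 1) ≤ F(n, ∏ qᵢ) G(p) (log max(3, max |eᵢ|))^τ`, then
`∑_{p ∣ x, p ≥ p₀} ord_p(x) log p ≤ F(#S, ∏ S) (log max(3, 3 log max(y,z)))^τ ∑_{p ∣ x, p ≥ p₀} G(p) log p`.
[folklore] -/
theorem sum_padicPart_le_general {F : ℕ → ℕ → ℝ} {G : ℕ → ℝ} {τ p₀ : ℕ}
    (hF : ∀ n P, 0 ≤ F n P) (hG : ∀ p, 0 ≤ G p)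
    (hP : ∀ (p n : ℕ) (q : Fin n → ℕ) (e : Fin n → ℤ), p.Prime → p₀ ≤ p →
      (∀ i, (q i).Prime) → Function.Injective q → (∀ i, q i ≠ p) → e ≠ 0 →
      ∏ i, ((q i : ℚ)) ^ e i ≠ 1 →
      (padicValRat p (∏ i, ((q i : ℚ)) ^ e i - 1) : ℝ) ≤
        F n (∏ i, q i) * G p *
          Real.log (max 3 ((Finset.univ.sup fun i => (e i).natAbs : ℕ) : ℝ)) ^ τ)
    {x y z : ℕ} (hx : 0 < x) (hy : 0 < y) (hz : 0 < z) (hyz : y ≠ z) (hcop : Nat.Coprime y z)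
    (hxcop : Nat.Coprime x (y * z)) (hdvd : (x : ℤ) ∣ (y : ℤ) ^ 2 - (z : ℤ) ^ 2) :
    ∑ p ∈ x.primeFactors.filter (fun p => p₀ ≤ p), (x.factorization p : ℝ) * Real.log p ≤
      F (y * z).primeFactors.card (∏ q ∈ (y * z).primeFactors, q) *
        Real.log (max 3 (3 * Real.log (max y z : ℕ))) ^ τ *
        ∑ p ∈ x.primeFactors.filter (fun p => p₀ ≤ p), G p * Real.log p := by
  classical
  have hy0 : y ≠ 0 := hy.ne'
  have hz0 : z ≠ 0 := hz.ne'
  have hx0 : x ≠ 0 := hx.ne'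
  set S := (y * z).primeFactors with hS
  set n := S.card with hn
  have hprime : ∀ q ∈ S, q.Prime := fun q hq => Nat.prime_of_mem_primeFactors hq
  -- the exponent vector and the `Fin n`-indexed family of primes
  set e : ℕ → ℤ := fun q => (y.factorization q : ℤ) - (z.factorization q : ℤ) with he
  set φ : Fin n ≃ S := S.equivFin.symm with hφ
  set q : Fin n → ℕ := fun i => (φ i : ℕ) with hqdef
  set e' : Fin n → ℤ := fun i => 2 * e (q i) with he'
  have hqS : ∀ i, q i ∈ S := fun i => (φ i).2
  have hqP : ∀ i, (q i).Prime := fun i => hprime _ (hqS i)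
  have hinj : Function.Injective q := fun i j hij =>
    φ.injective (Subtype.ext hij)
  -- `S` is nonempty and every `e_q`, `q ∈ S`, is non-zero
  have hyz1 : 1 < y * z := by
    rcases Nat.lt_or_ge 1 y with h | h
    · nlinarith
    · have hy1 : y = 1 := by omega
      subst hy1
      have : 1 < z := by omega
      simpa using this
  have hSne : S.Nonempty := Nat.nonempty_primeFactors.mpr hyz1
  have hn0 : 0 < n := Finset.card_pos.mpr hSne
  have he_ne : ∀ r ∈ S, e r ≠ 0 := by
    intro r hr
    have hrP := hprime r hr
    have hrdvd : r ∣ y * z := Nat.dvd_of_mem_primeFactors hr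
    rcases (Nat.Prime.dvd_mul hrP).mp hrdvd with hry | hrz
    · have h1 : 0 < y.factorization r := hrP.factorization_pos_of_dvd hy0 hry
      have h2 : z.factorization r = 0 := by
        apply Nat.factorization_eq_zero_of_not_dvd
        intro hrz
        exact hrP.one_lt.ne' (Nat.eq_one_of_dvd_coprimes hcop hry hrz)
      simp only [he, h2]; omega
    · have h1 : 0 < z.factorization r := hrP.factorization_pos_of_dvd hz0 hrz
      have h2 : y.factorization r = 0 := by
        apply Nat.factorization_eq_zero_of_not_dvd
        intro hry
        exact hrP.one_lt.ne' (Nat.eq_one_of_dvd_coprimes hcop hry hrz)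
      simp only [he, h2]; omega
  have he'ne : e' ≠ 0 := by
    intro h0
    obtain ⟨i⟩ : Nonempty (Fin n) := ⟨⟨0, hn0⟩⟩
    have := congr_fun h0 i
    simp only [he', Pi.zero_apply, mul_eq_zero, OfNat.ofNat_ne_zero, false_or] at this
    exact he_ne _ (hqS i) this
  -- `∏ q_i^{e'_i} = (y/z)²`
  have hfac : ∀ {m : ℕ}, m ≠ 0 → m ∣ y * z →
      (m : ℚ) = ∏ r ∈ S, (r : ℚ) ^ m.factorization r := by
    intro m hm hmd
    have h1 := Nat.prod_primeFactors_pow_factorization hm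
    have hsub : m.primeFactors ⊆ S := Nat.primeFactors_mono hmd (mul_ne_zero hy0 hz0)
    rw [← Finset.prod_subset hsub (fun r hrS hr => ?_)]
    · exact_mod_cast h1
    · have hnd : ¬ r ∣ m := fun hd => hr (Nat.mem_primeFactors.mpr ⟨hprime r hrS, hd, hm⟩)
      rw [Nat.factorization_eq_zero_of_not_dvd hnd, pow_zero]
  have hprodS : ∏ r ∈ S, (r : ℚ) ^ e r = (y : ℚ) / z := by
    rw [hfac hy0 (dvd_mul_right y z), hfac hz0 (dvd_mul_left z y), ← Finset.prod_div_distrib]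
    refine Finset.prod_congr rfl fun r hr => ?_
    have hr0 : (r : ℚ) ≠ 0 := by exact_mod_cast (hprime r hr).ne_zero
    rw [he, zpow_sub₀ hr0, zpow_natCast, zpow_natCast]
  have hprod : ∏ i, ((q i : ℚ)) ^ e' i = ((y : ℚ) / z) ^ 2 := by
    have h1 : ∏ i, ((q i : ℚ)) ^ e' i = ∏ i, (((q i : ℚ)) ^ e (q i)) ^ 2 := by
      refine Finset.prod_congr rfl fun i _ => ?_
      show ((q i : ℚ)) ^ (2 * e (q i)) = (((q i : ℚ)) ^ e (q i)) ^ 2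
      rw [mul_comm, zpow_mul, zpow_ofNat]
    have h2 : ∏ i, (((q i : ℚ)) ^ e (q i)) ^ 2 = (∏ i, ((q i : ℚ)) ^ e (q i)) ^ 2 :=
      Finset.prod_pow _ 2 _
    have h3 : ∏ i, ((q i : ℚ)) ^ e (q i) = ∏ r ∈ S, (r : ℚ) ^ e r := by
      rw [← Finset.prod_coe_sort S (fun r => (r : ℚ) ^ e r)]
      exact Fintype.prod_equiv φ (fun i => ((q i : ℚ)) ^ e (q i)) (fun r => ((r : ℕ) : ℚ) ^ e r)
        (fun i => rfl)
    rw [h1, h2, h3, hprodS]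
  have hyzQ : (y : ℚ) / z ≠ 1 := by
    intro h
    rw [div_eq_one_iff_eq (by exact_mod_cast hz0)] at h
    exact hyz (by exact_mod_cast h)
  have hyzQ' : (y : ℚ) / z ≠ -1 := by
    intro h
    have : (0 : ℚ) < (y : ℚ) / z := div_pos (by exact_mod_cast hy) (by exact_mod_cast hz)
    rw [h] at this; norm_num at this
  have hne1 : ∏ i, ((q i : ℚ)) ^ e' i ≠ 1 := by
    rw [hprod]
    intro h
    rcases sq_eq_one_iff.mp h with h1 | h1
    · exact hyzQ h1
    · exact hyzQ' h1
  -- the integer `m = y² − z² ≠ 0` and `(y/z)² − 1 = m / z²`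
  set m : ℤ := (y : ℤ) ^ 2 - (z : ℤ) ^ 2 with hm
  have hm0 : m ≠ 0 := by
    intro h
    have h' : ((y : ℤ)) ^ 2 = (z : ℤ) ^ 2 := sub_eq_zero.mp h
    have h'' : y ^ 2 = z ^ 2 := by exact_mod_cast h'
    exact hyz (Nat.pow_left_injective (by norm_num) h'')
  have hΛ : ∏ i, ((q i : ℚ)) ^ e' i - 1 = (m : ℚ) / ((z : ℚ)) ^ 2 := by
    rw [hprod, hm]; push_cast
    field_simp
  -- heights and the sup of the exponents
  have hPiq : ∏ i, q i = ∏ r ∈ S, r := by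
    rw [← Finset.prod_coe_sort S (fun r => r)]
    exact Fintype.prod_equiv φ (fun i => q i) (fun r => (r : ℕ)) (fun i => rfl)
  have hl2 : 0.6931471803 < Real.log 2 := Real.log_two_gt_d9
  have hmax1 : (1 : ℝ) ≤ (max y z : ℕ) := by exact_mod_cast (show 1 ≤ max y z from le_max_of_le_left hy)
  have hlogmax0 : 0 ≤ Real.log (max y z : ℕ) := Real.log_nonneg hmax1
  have hsup : (((Finset.univ.sup fun i => (e' i).natAbs : ℕ)) : ℝ) ≤ 3 * Real.log (max y z : ℕ) := by
    obtain ⟨i, -, hi⟩ := Finset.exists_mem_eq_sup (Finset.univ : Finset (Fin n))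
      (Finset.univ_nonempty_iff.mpr ⟨⟨0, hn0⟩⟩) (fun i => (e' i).natAbs)
    rw [hi]
    have hfy := factorization_mul_log_two_le (q := q i) (hqP i) hy0
    have hfz := factorization_mul_log_two_le (q := q i) (hqP i) hz0
    have hly : Real.log y ≤ Real.log (max y z : ℕ) :=
      Real.log_le_log (by exact_mod_cast hy) (by exact_mod_cast le_max_left y z)
    have hlz : Real.log z ≤ Real.log (max y z : ℕ) :=
      Real.log_le_log (by exact_mod_cast hz) (by exact_mod_cast le_max_right y z)
    have hyf0 : (0 : ℝ) ≤ y.factorization (q i) := Nat.cast_nonneg _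
    have hzf0 : (0 : ℝ) ≤ z.factorization (q i) := Nat.cast_nonneg _
    have hpy := mul_nonneg hyf0 (sub_nonneg.mpr hl2.le)
    have hpz := mul_nonneg hzf0 (sub_nonneg.mpr hl2.le)
    rcases le_total (y.factorization (q i)) (z.factorization (q i)) with h | h
    · have h1 : (e' i).natAbs ≤ 2 * z.factorization (q i) := by
        simp only [he', he]; omega
      have h1' : ((e' i).natAbs : ℝ) ≤ 2 * (z.factorization (q i) : ℝ) := by exact_mod_cast h1
      linarith
    · have h1 : (e' i).natAbs ≤ 2 * y.factorization (q i) := by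
        simp only [he', he]; omega
      have h1' : ((e' i).natAbs : ℝ) ≤ 2 * (y.factorization (q i) : ℝ) := by exact_mod_cast h1
      linarith
  -- the per-prime estimate
  set T := x.primeFactors.filter (fun p => p₀ ≤ p) with hT
  have hterm : ∀ p ∈ T, (x.factorization p : ℝ) * Real.log p ≤
      F n (∏ r ∈ S, r) *
        Real.log (max 3 (3 * Real.log (max y z : ℕ))) ^ τ * (G p * Real.log p) := by
    intro p hp
    obtain ⟨hpx, hp₀⟩ := Finset.mem_filter.mp hp
    have hpP : p.Prime := Nat.prime_of_mem_primeFactors hpx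
    haveI : Fact p.Prime := ⟨hpP⟩
    have hpdx : p ∣ x := Nat.dvd_of_mem_primeFactors hpx
    have hpyz : ¬ p ∣ y * z := fun hd =>
      hpP.one_lt.ne' (Nat.eq_one_of_dvd_coprimes hxcop hpdx hd)
    have hpz : ¬ p ∣ z := fun hd => hpyz (dvd_mul_of_dvd_right hd y)
    have hqp : ∀ i, q i ≠ p := fun i h => hpyz (h ▸ Nat.dvd_of_mem_primeFactors (hqS i))
    -- `ord_p x ≤ ord_p ((y/z)² − 1)`
    have hval : (x.factorization p : ℤ) ≤ padicValRat p (∏ i, ((q i : ℚ)) ^ e' i - 1) := by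
      rw [hΛ, padicValRat.div (by exact_mod_cast hm0) (pow_ne_zero 2 (by exact_mod_cast hz0)),
        padicValRat.pow, padicValRat.of_nat, padicValNat.eq_zero_of_not_dvd hpz]
      simp only [Nat.cast_zero, mul_zero, sub_zero]
      rw [padicValRat.of_int]
      have hdvd' : (p : ℤ) ^ x.factorization p ∣ m :=
        dvd_trans (by exact_mod_cast Nat.ordProj_dvd x p) hdvd
      have := (padicValInt_dvd_iff _ _).mp hdvd'
      rcases this with h | h
      · exact absurd h hm0
      · exact_mod_cast h
    have hval' : (x.factorization p : ℝ) ≤ (padicValRat p (∏ i, ((q i : ℚ)) ^ e' i - 1) : ℝ) := by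
      exact_mod_cast hval
    have key := hP p n q e' hpP hp₀ hqP hinj hqp he'ne hne1
    rw [hPiq] at key
    have hlogp : 0 ≤ Real.log p := Real.log_nonneg (by exact_mod_cast hpP.one_lt.le)
    have hpre : 0 ≤ F n (∏ r ∈ S, r) * G p := mul_nonneg (hF _ _) (hG _)
    have hlog3 : 0 ≤ Real.log (max 3 (((Finset.univ.sup fun i => (e' i).natAbs : ℕ)) : ℝ)) :=
      Real.log_nonneg (le_trans (by norm_num) (le_max_left _ _))
    have hmono : Real.log (max 3 (((Finset.univ.sup fun i => (e' i).natAbs : ℕ)) : ℝ)) ^ τ ≤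
        Real.log (max 3 (3 * Real.log (max y z : ℕ))) ^ τ := by
      apply pow_le_pow_left₀ hlog3
      apply Real.log_le_log (lt_of_lt_of_le (by norm_num) (le_max_left _ _))
      exact max_le_max le_rfl hsup
    calc (x.factorization p : ℝ) * Real.log p
        ≤ (F n (∏ r ∈ S, r) * G p *
            Real.log (max 3 (((Finset.univ.sup fun i => (e' i).natAbs : ℕ)) : ℝ)) ^ τ) *
            Real.log p := mul_le_mul_of_nonneg_right (hval'.trans key) hlogp
      _ ≤ (F n (∏ r ∈ S, r) * G p *
            Real.log (max 3 (3 * Real.log (max y z : ℕ))) ^ τ) * Real.log p :=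
          mul_le_mul_of_nonneg_right (mul_le_mul_of_nonneg_left hmono hpre) hlogp
      _ = _ := by ring
  calc ∑ p ∈ T, (x.factorization p : ℝ) * Real.log p
      ≤ ∑ p ∈ T, F n (∏ r ∈ S, r) *
          Real.log (max 3 (3 * Real.log (max y z : ℕ))) ^ τ * (G p * Real.log p) :=
        Finset.sum_le_sum hterm
    _ = _ := by rw [← Finset.mul_sum]

/-! ### The endgame for Theorem D -/

open StewartTijdemanGeneric in
/-- `(log ∏ S)^{#S} ≤ (8e)^{#S} (∏ S)^{9/8}` for a finite set `S` of primes
(`log P = n log P^{1/n} ≤ 8n P^{1/(8n)}`, `nⁿ ≤ eⁿ n! ≤ eⁿ ∏ S`). [folklore] -/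
theorem log_prod_pow_card_le {S : Finset ℕ} (hS : ∀ q ∈ S, q.Prime) :
    Real.log ((((∏ q ∈ S, q : ℕ)) : ℝ)) ^ S.card ≤
      (8 * Real.exp 1) ^ S.card * ((((∏ q ∈ S, q : ℕ)) : ℝ)) ^ (9 / 8 : ℝ) := by
  set n := S.card with hn
  set P : ℝ := ((((∏ q ∈ S, q : ℕ)) : ℝ)) with hP
  have hP1 : 1 ≤ P := by
    rw [hP]; exact_mod_cast Finset.prod_pos fun q hq => (hS q hq).pos
  have hP0 : 0 < P := by linarith
  rcases Nat.eq_zero_or_pos n with hn0 | hn0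
  · rw [hn0, pow_zero, pow_zero, one_mul]
    exact Real.one_le_rpow hP1 (by norm_num)
  · have hnR : (0 : ℝ) < n := by exact_mod_cast hn0
    have hε : (0 : ℝ) < 1 / (8 * (n : ℝ)) := by positivity
    have hlog : Real.log P ≤ 8 * n * P ^ (1 / (8 * (n : ℝ))) := by
      have h := Real.log_le_rpow_div hP0.le hε
      calc Real.log P ≤ P ^ (1 / (8 * (n : ℝ))) / (1 / (8 * (n : ℝ))) := h
        _ = 8 * n * P ^ (1 / (8 * (n : ℝ))) := by
            rw [div_eq_mul_inv, one_div, inv_inv]; ring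
    have hlog0 : 0 ≤ Real.log P := Real.log_nonneg hP1
    have hfact : ((n.factorial : ℕ) : ℝ) ≤ P := by
      rw [hP]
      exact_mod_cast factorial_card_le_prod n S hn.symm fun q hq => (hS q hq).one_lt.le
    have hexp : Real.exp (n : ℝ) = Real.exp 1 ^ n := by
      rw [← Real.exp_one_rpow, Real.rpow_natCast]
    have hnn : (n : ℝ) ^ n ≤ Real.exp 1 ^ n * P :=
      calc (n : ℝ) ^ n ≤ Real.exp n * n.factorial := pow_self_le_exp_mul_factorial n
        _ = Real.exp 1 ^ n * n.factorial := by rw [hexp]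
        _ ≤ Real.exp 1 ^ n * P := mul_le_mul_of_nonneg_left hfact (pow_nonneg (Real.exp_pos 1).le n)
    have hpow : (P ^ (1 / (8 * (n : ℝ)))) ^ n = P ^ (1 / 8 : ℝ) := by
      rw [← Real.rpow_mul_natCast hP0.le]
      congr 1
      field_simp
    calc Real.log P ^ n ≤ (8 * n * P ^ (1 / (8 * (n : ℝ)))) ^ n := pow_le_pow_left₀ hlog0 hlog n
      _ = 8 ^ n * (n : ℝ) ^ n * P ^ (1 / 8 : ℝ) := by rw [mul_pow, mul_pow, hpow]
      _ ≤ 8 ^ n * (Real.exp 1 ^ n * P) * P ^ (1 / 8 : ℝ) := by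
          apply mul_le_mul_of_nonneg_right _ (Real.rpow_nonneg hP0.le _)
          exact mul_le_mul_of_nonneg_left hnn (pow_nonneg (by norm_num) n)
      _ = (8 * Real.exp 1) ^ n * (P ^ (1 : ℝ) * P ^ (1 / 8 : ℝ)) := by rw [Real.rpow_one, mul_pow]; ring
      _ = (8 * Real.exp 1) ^ n * P ^ (9 / 8 : ℝ) := by
          rw [← Real.rpow_add hP0]; norm_num

open StewartTijdemanGeneric in
/-- **The bound for one abc triple along Theorem D.** From the prime-family bound of
`primeFamilyBound_of_principalUnitBound` (class functions
`F(n, P) = K (2m₀)^τ (2L)ⁿ n^{κn} n^{2τ} (log P)ⁿ`, `G(p) = p^{σ+m₀} (log 3p)^τ`) with `κ ≤ 13`,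
`σ + m₀ ≤ 14`, and `A` with `(2L e^κ 4^τ 8e)^{#S} ≤ A (∏ S)^{1/8}`: for an abc triple with
`a ≠ b`, `log c ≤ 24 K (2m₀)^τ 2^τ (30(τ+1))^τ A · rad(abc)^{29/2} · (log max(3, log c))^τ`.
Book-keeping (`P₁ = rad(ab)`, `Pₓ = rad(c)`): `n^{κn} ≤ e^{κn} P₁^κ`, `n^{2τ} ≤ (4^τ)ⁿ`,
`(log P₁)ⁿ ≤ (8e)ⁿ P₁^{9/8}` (`log_prod_pow_card_le`), so `F ≤ K (2m₀)^τ A P₁^{κ+5/4}`;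
`∑_{p ∣ c} G(p) log p ≤ (log 3Pₓ)^τ Pₓ^{σ+m₀} log Pₓ ≤ 24 (30(τ+1))^τ Pₓ^{σ+m₀+1/4}`; and
`κ + 5/4, σ + m₀ + 1/4 ≤ 29/2`. [folklore] -/
theorem abc_log_le_of_principalClass {K L κ σ : ℝ} {τ m₀ : ℕ} (hK : 0 ≤ K) (hL : 1 ≤ L)
    (hκ0 : 0 ≤ κ) (hκ : κ ≤ 13) (hσ0 : 0 ≤ σ) (hσm : σ + m₀ ≤ 14)
    (hP : ∀ (p n : ℕ) (q : Fin n → ℕ) (e : Fin n → ℤ), p.Prime →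
      (∀ i, (q i).Prime) → Function.Injective q → (∀ i, q i ≠ p) → e ≠ 0 →
      ∏ i, ((q i : ℚ)) ^ e i ≠ 1 →
      (padicValRat p (∏ i, ((q i : ℚ)) ^ e i - 1) : ℝ) ≤
        K * (2 * (m₀ : ℝ)) ^ τ * (2 * L) ^ n * (n : ℝ) ^ (κ * n) * (n : ℝ) ^ (2 * τ) *
            Real.log (((∏ i, q i : ℕ)) : ℝ) ^ n *
          ((p : ℝ) ^ (σ + m₀) * Real.log (3 * p) ^ τ) *
          Real.log (max 3 ((Finset.univ.sup fun i => (e i).natAbs : ℕ) : ℝ)) ^ τ)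
    {A : ℝ} (hA0 : 0 ≤ A)
    (hA : ∀ S : Finset ℕ, (∀ q ∈ S, q.Prime) →
      (2 * L * Real.exp κ * 4 ^ τ * (8 * Real.exp 1)) ^ S.card ≤
        A * (((∏ q ∈ S, q : ℕ)) : ℝ) ^ (1 / 8 : ℝ))
    {a b c : ℕ} (ht : IsABCTriple a b c) (hab : a ≠ b) :
    Real.log c ≤ 24 * K * (2 * (m₀ : ℝ)) ^ τ * 2 ^ τ * (30 * ((τ : ℝ) + 1)) ^ τ * A *
      (rad a b c : ℝ) ^ (29 / 2 : ℝ) * Real.log (max 3 (Real.log c)) ^ τ := by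
  classical
  obtain ⟨ha, hb, habc, hcop⟩ := ht
  have hc0 : c ≠ 0 := by omega
  have ha0 : a ≠ 0 := ha.ne'
  have hb0 : b ≠ 0 := hb.ne'
  -- the class functions
  set F : ℕ → ℕ → ℝ := fun n P => K * (2 * (m₀ : ℝ)) ^ τ * (2 * L) ^ n * (n : ℝ) ^ (κ * n) *
    (n : ℝ) ^ (2 * τ) * Real.log (P : ℝ) ^ n with hF
  set G : ℕ → ℝ := fun p => (p : ℝ) ^ (σ + m₀) * Real.log (3 * p) ^ τ with hG
  have hL0 : 0 ≤ L := by linarith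
  have hF0 : ∀ n P, 0 ≤ F n P := by
    intro n P
    have hlog : 0 ≤ Real.log (P : ℝ) := Real.log_natCast_nonneg P
    simp only [hF]
    positivity
  have hG0 : ∀ p, 0 ≤ G p := by
    intro p
    simp only [hG]
    have h1 : 0 ≤ (p : ℝ) ^ (σ + m₀) := Real.rpow_nonneg (Nat.cast_nonneg p) _
    have h2 : 0 ≤ Real.log (3 * p) ^ τ := by
      rcases Nat.eq_zero_or_pos p with hp | hp
      · subst hp; simp
      · exact pow_nonneg (Real.log_nonneg (by
          have : (1 : ℝ) ≤ p := by exact_mod_cast hp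
          linarith)) τ
    exact mul_nonneg h1 h2
  have hP' : ∀ (p n : ℕ) (q : Fin n → ℕ) (e : Fin n → ℤ), p.Prime → 0 ≤ p →
      (∀ i, (q i).Prime) → Function.Injective q → (∀ i, q i ≠ p) → e ≠ 0 →
      ∏ i, ((q i : ℚ)) ^ e i ≠ 1 →
      (padicValRat p (∏ i, ((q i : ℚ)) ^ e i - 1) : ℝ) ≤
        F n (∏ i, q i) * G p *
          Real.log (max 3 ((Finset.univ.sup fun i => (e i).natAbs : ℕ) : ℝ)) ^ τ := by
    intro p n q e hp _ hq hinj hqp he hne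
    have h := hP p n q e hp hq hinj hqp he hne
    simp only [hF, hG]
    exact h
  -- the summation at `x = c`, `{y, z} = {a, b}`
  have hcopc : Nat.Coprime c (a * b) := by
    have hac : Nat.Coprime a c := by rw [← habc]; exact Nat.coprime_self_add_right.mpr hcop
    have hbc : Nat.Coprime b c := by rw [← habc]; exact Nat.coprime_add_self_right.mpr hcop.symm
    exact (Nat.Coprime.mul_left hac hbc).symm
  have hdvd : (c : ℤ) ∣ (a : ℤ) ^ 2 - (b : ℤ) ^ 2 :=
    ⟨(a : ℤ) - b, by rw [← habc]; push_cast; ring⟩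
  have hsum := sum_padicPart_le_general (p₀ := 0) hF0 hG0 hP' (by omega) ha hb hab hcop hcopc hdvd
  -- the left-hand side is `log c`
  have hfilter : c.primeFactors.filter (fun p => 0 ≤ p) = c.primeFactors :=
    Finset.filter_true_of_mem fun p _ => Nat.zero_le p
  have hlogc : Real.log c = ∑ p ∈ c.primeFactors, (c.factorization p : ℝ) * Real.log p := by
    have h1 := Nat.prod_primeFactors_pow_factorization hc0
    have h2 : (c : ℝ) = ∏ p ∈ c.primeFactors, (p : ℝ) ^ c.factorization p := by
      exact_mod_cast h1
    rw [h2, Real.log_prod]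
    · exact Finset.sum_congr rfl fun p _ => Real.log_pow _ _
    · intro p hp
      exact pow_ne_zero _ (by exact_mod_cast (Nat.prime_of_mem_primeFactors hp).ne_zero)
  rw [hfilter, ← hlogc] at hsum
  -- notation
  set S := (a * b).primeFactors with hS
  set n := S.card with hn
  set P₁ : ℝ := (((∏ q ∈ S, q : ℕ)) : ℝ) with hP₁
  set Px : ℝ := (((∏ p ∈ c.primeFactors, p : ℕ)) : ℝ) with hPx
  set W : ℝ := Real.log (max 3 (Real.log (max a b : ℕ))) with hW
  set Y : ℝ := Real.log (max 3 (Real.log c)) with hY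
  set Φ : ℝ := Real.log (max 3 (3 * Real.log (max a b : ℕ))) ^ τ with hΦ
  set Cτ : ℝ := (30 * ((τ : ℝ) + 1)) ^ τ with hCτ
  set σ' : ℝ := σ + m₀ with hσ'
  have hσ'0 : 0 ≤ σ' := by rw [hσ']; positivity
  have hprimeS : ∀ q ∈ S, q.Prime := fun q hq => Nat.prime_of_mem_primeFactors hq
  have hprimeX : ∀ p ∈ c.primeFactors, p.Prime := fun p hp => Nat.prime_of_mem_primeFactors hp
  have hP₁1 : 1 ≤ P₁ := by
    rw [hP₁]; exact_mod_cast Finset.prod_pos fun q hq => (hprimeS q hq).pos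
  have hPx1 : 1 ≤ Px := by
    rw [hPx]; exact_mod_cast Finset.prod_pos fun p hp => (hprimeX p hp).pos
  have hP₁0 : 0 < P₁ := by linarith
  have hPx0 : 0 < Px := by linarith
  -- the radical of `abc`
  have hRad : (rad a b c : ℝ) = Px * P₁ := by
    have h1 : (((∏ q ∈ (c * (a * b)).primeFactors, q : ℕ)) : ℝ) = Px * P₁ := by
      rw [hPx, hP₁, hS, Nat.Coprime.primeFactors_mul hcopc,
        Finset.prod_union hcopc.disjoint_primeFactors]
      push_cast; ring
    rw [← h1, rad_def, Nat.radical_eq_prod_primeFactors, show c * (a * b) = a * b * c by ring]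
  -- (1) `F n P₁ ≤ K (2m₀)^τ A P₁^{κ + 5/4}`
  have hfact : ((n.factorial : ℕ) : ℝ) ≤ P₁ := by
    rw [hP₁]
    exact_mod_cast factorial_card_le_prod n S hn.symm fun q hq => (hprimeS q hq).one_lt.le
  have h1 : (n : ℝ) ^ (κ * n) ≤ Real.exp κ ^ n * P₁ ^ κ :=
    (rpow_mul_self_le hκ0 n).trans
      (mul_le_mul_of_nonneg_left (Real.rpow_le_rpow (Nat.cast_nonneg _) hfact hκ0)
        (pow_nonneg (Real.exp_pos κ).le n))
  have h2 : (n : ℝ) ^ (2 * τ) ≤ (4 ^ τ : ℝ) ^ n := by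
    have hn2 : (n : ℝ) ≤ 2 ^ n := by exact_mod_cast Nat.lt_two_pow_self.le
    calc (n : ℝ) ^ (2 * τ) ≤ ((2 : ℝ) ^ n) ^ (2 * τ) := pow_le_pow_left₀ (Nat.cast_nonneg n) hn2 _
      _ = (4 ^ τ : ℝ) ^ n := by
          rw [← pow_mul, ← pow_mul, show (4 : ℝ) = 2 ^ 2 by norm_num, ← pow_mul]; ring_nf
  have h3 : Real.log P₁ ^ n ≤ (8 * Real.exp 1) ^ n * P₁ ^ (9 / 8 : ℝ) := by
    rw [hP₁, hn]; exact log_prod_pow_card_le hprimeS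
  have hCn : (2 * L * Real.exp κ * 4 ^ τ * (8 * Real.exp 1)) ^ n =
      (2 * L) ^ n * Real.exp κ ^ n * (4 ^ τ : ℝ) ^ n * (8 * Real.exp 1) ^ n := by
    rw [mul_pow, mul_pow, mul_pow]
  have h5 : (2 * L) ^ n * Real.exp κ ^ n * (4 ^ τ : ℝ) ^ n * (8 * Real.exp 1) ^ n ≤
      A * P₁ ^ (1 / 8 : ℝ) := by
    rw [← hCn]; exact hA S hprimeS
  have hexp₁ : (1 / 8 : ℝ) + κ + 9 / 8 = κ + 5 / 4 := by ring
  have hFle : F n (∏ q ∈ S, q) ≤ K * (2 * (m₀ : ℝ)) ^ τ * A * P₁ ^ (κ + 5 / 4) := by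
    have hK2 : 0 ≤ K * (2 * (m₀ : ℝ)) ^ τ := by positivity
    calc F n (∏ q ∈ S, q) = K * (2 * (m₀ : ℝ)) ^ τ * ((2 * L) ^ n * (n : ℝ) ^ (κ * n) *
          (n : ℝ) ^ (2 * τ) * Real.log P₁ ^ n) := by simp only [hF, hP₁]; ring
      _ ≤ K * (2 * (m₀ : ℝ)) ^ τ * ((2 * L) ^ n * (Real.exp κ ^ n * P₁ ^ κ) *
          ((4 ^ τ : ℝ) ^ n) * ((8 * Real.exp 1) ^ n * P₁ ^ (9 / 8 : ℝ))) := by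
          apply mul_le_mul_of_nonneg_left _ hK2
          have h2L : 0 ≤ (2 * L) ^ n := pow_nonneg (by linarith) n
          apply mul_le_mul _ h3 (pow_nonneg (Real.log_nonneg hP₁1) n) (by positivity)
          apply mul_le_mul _ h2 (by positivity) (by positivity)
          exact mul_le_mul_of_nonneg_left h1 h2L
      _ = K * (2 * (m₀ : ℝ)) ^ τ *
          ((2 * L) ^ n * Real.exp κ ^ n * (4 ^ τ : ℝ) ^ n * (8 * Real.exp 1) ^ n) *
          (P₁ ^ κ * P₁ ^ (9 / 8 : ℝ)) := by ring
      _ ≤ K * (2 * (m₀ : ℝ)) ^ τ * (A * P₁ ^ (1 / 8 : ℝ)) * (P₁ ^ κ * P₁ ^ (9 / 8 : ℝ)) := by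
          apply mul_le_mul_of_nonneg_right _ (by positivity)
          exact mul_le_mul_of_nonneg_left h5 hK2
      _ = K * (2 * (m₀ : ℝ)) ^ τ * A * (P₁ ^ (1 / 8 : ℝ) * P₁ ^ κ * P₁ ^ (9 / 8 : ℝ)) := by ring
      _ = K * (2 * (m₀ : ℝ)) ^ τ * A * P₁ ^ (κ + 5 / 4) := by
          rw [← Real.rpow_add hP₁0, ← Real.rpow_add hP₁0, hexp₁]
  -- (2) `Φ ≤ 2^τ W^τ` and `W ≤ Y`
  have hW1 : 1 ≤ W := by
    rw [hW]
    have h3' : Real.log 3 ≤ Real.log (max 3 (Real.log (max a b : ℕ))) :=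
      Real.log_le_log (by norm_num) (le_max_left _ _)
    have hl3 : 1 ≤ Real.log 3 := by
      rw [Real.le_log_iff_exp_le (by norm_num)]
      exact Real.exp_one_lt_d9.le.trans (by norm_num)
    linarith
  have hW0 : 0 ≤ W := by linarith
  have hΦle : Φ ≤ 2 ^ τ * W ^ τ := by
    rw [hΦ, ← mul_pow]
    apply pow_le_pow_left₀ (Real.log_nonneg (le_trans (by norm_num) (le_max_left _ _)))
    have hmax0 : 0 < max 3 (Real.log (max a b : ℕ)) := lt_of_lt_of_le (by norm_num) (le_max_left _ _)
    have hle : max 3 (3 * Real.log (max a b : ℕ)) ≤ 3 * max 3 (Real.log (max a b : ℕ)) :=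
      max_le (by linarith [le_max_left (3 : ℝ) (Real.log (max a b : ℕ))])
        (by linarith [le_max_right (3 : ℝ) (Real.log (max a b : ℕ))])
    calc Real.log (max 3 (3 * Real.log (max a b : ℕ)))
        ≤ Real.log (3 * max 3 (Real.log (max a b : ℕ))) :=
          Real.log_le_log (lt_of_lt_of_le (by norm_num) (le_max_left _ _)) hle
      _ = Real.log 3 + W := by rw [Real.log_mul (by norm_num) hmax0.ne', hW]
      _ ≤ 2 * W := by
          have : Real.log 3 ≤ W := Real.log_le_log (by norm_num) (le_max_left _ _)
          linarith
  have hmaxc : Real.log (max a b : ℕ) ≤ Real.log c :=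
    Real.log_le_log (by exact_mod_cast lt_max_of_lt_left ha)
      (by exact_mod_cast (max_le (by omega) (by omega) : max a b ≤ c))
  have hWY : W ≤ Y := Real.log_le_log (lt_of_lt_of_le (by norm_num) (le_max_left _ _))
    (max_le_max le_rfl hmaxc)
  have hY0 : 0 ≤ Y := hW0.trans hWY
  have hΦY : Φ ≤ 2 ^ τ * Y ^ τ :=
    hΦle.trans (mul_le_mul_of_nonneg_left (pow_le_pow_left₀ hW0 hWY τ) (by positivity))
  -- (3) `∑_{p ∣ c} G p log p ≤ 24 Cτ Px^{σ' + 1/4}`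
  set T := c.primeFactors with hT
  have hCτ0 : 0 ≤ Cτ := by rw [hCτ]; positivity
  have hGsum : ∑ p ∈ T, G p * Real.log p ≤ 24 * Cτ * Px ^ (σ' + 1 / 4) := by
    -- `G p log p ≤ (log 3Px)^τ · p^σ' log p`
    have hterm : ∀ p ∈ T, G p * Real.log p ≤
        Real.log (3 * Px) ^ τ * ((p : ℝ) ^ σ' * Real.log p) := by
      intro p hp
      have hpP := hprimeX p hp
      have hp1 : (1 : ℝ) ≤ p := by exact_mod_cast hpP.one_lt.le
      have hple : (p : ℝ) ≤ Px := by
        rw [hPx]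
        exact_mod_cast Nat.le_of_dvd (Finset.prod_pos fun p hp => (hprimeX p hp).pos)
          (Finset.dvd_prod_of_mem _ hp)
      have hlog3p : Real.log (3 * p) ≤ Real.log (3 * Px) :=
        Real.log_le_log (by linarith) (by linarith)
      have hlog3p0 : 0 ≤ Real.log (3 * p) := Real.log_nonneg (by linarith)
      have hlogp0 : 0 ≤ Real.log p := Real.log_nonneg hp1
      simp only [hG]
      calc (p : ℝ) ^ σ' * Real.log (3 * p) ^ τ * Real.log p
          ≤ (p : ℝ) ^ σ' * Real.log (3 * Px) ^ τ * Real.log p := by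
            apply mul_le_mul_of_nonneg_right _ hlogp0
            exact mul_le_mul_of_nonneg_left (pow_le_pow_left₀ hlog3p0 hlog3p τ)
              (Real.rpow_nonneg (Nat.cast_nonneg p) _)
        _ = Real.log (3 * Px) ^ τ * ((p : ℝ) ^ σ' * Real.log p) := by ring
    have hsumT : ∑ p ∈ T, G p * Real.log p ≤
        Real.log (3 * Px) ^ τ * ∑ p ∈ T, (p : ℝ) ^ σ' * Real.log p := by
      rw [Finset.mul_sum]; exact Finset.sum_le_sum hterm
    -- `∑ p^σ' log p ≤ Px^σ' log Px ≤ 8 Px^{σ'} Px^{1/8}`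
    have hsg : ∑ p ∈ T, (p : ℝ) ^ σ' * Real.log p ≤ 8 * (Px ^ σ' * Px ^ (1 / 8 : ℝ)) := by
      have h := sum_rpow_mul_log_le hprimeX hσ'0
      have hlog : Real.log Px ≤ Px ^ (1 / 8 : ℝ) / (1 / 8) :=
        Real.log_le_rpow_div (zero_le_one.trans hPx1) (by norm_num)
      calc ∑ p ∈ T, (p : ℝ) ^ σ' * Real.log p ≤ Px ^ σ' * Real.log Px := h
        _ ≤ Px ^ σ' * (Px ^ (1 / 8 : ℝ) / (1 / 8)) :=
            mul_le_mul_of_nonneg_left hlog (Real.rpow_nonneg (zero_le_one.trans hPx1) σ')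
        _ = 8 * (Px ^ σ' * Px ^ (1 / 8 : ℝ)) := by ring
    -- `(log 3Px)^τ ≤ 3 Cτ Px^{1/8}`
    have h3Px1 : 1 ≤ 3 * Px := by linarith
    have hlogpow : Real.log (3 * Px) ^ τ ≤ 3 * Cτ * Px ^ (1 / 8 : ℝ) := by
      have h := log_pow_le_rpow τ h3Px1
      have h30 : (3 * Px) ^ (1 / 30 : ℝ) ≤ 3 * Px ^ (1 / 8 : ℝ) := by
        calc (3 * Px) ^ (1 / 30 : ℝ) ≤ (3 * Px) ^ (1 / 8 : ℝ) :=
              Real.rpow_le_rpow_of_exponent_le h3Px1 (by norm_num)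
          _ = (3 : ℝ) ^ (1 / 8 : ℝ) * Px ^ (1 / 8 : ℝ) := Real.mul_rpow (by norm_num) hPx0.le
          _ ≤ 3 * Px ^ (1 / 8 : ℝ) := by
              apply mul_le_mul_of_nonneg_right _ (Real.rpow_nonneg hPx0.le _)
              calc (3 : ℝ) ^ (1 / 8 : ℝ) ≤ (3 : ℝ) ^ (1 : ℝ) :=
                    Real.rpow_le_rpow_of_exponent_le (by norm_num) (by norm_num)
                _ = 3 := Real.rpow_one 3
      calc Real.log (3 * Px) ^ τ ≤ Cτ * (3 * Px) ^ (1 / 30 : ℝ) := by rw [hCτ]; exact h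
        _ ≤ Cτ * (3 * Px ^ (1 / 8 : ℝ)) := mul_le_mul_of_nonneg_left h30 hCτ0
        _ = 3 * Cτ * Px ^ (1 / 8 : ℝ) := by ring
    have hsg0 : 0 ≤ ∑ p ∈ T, (p : ℝ) ^ σ' * Real.log p := Finset.sum_nonneg fun p hp =>
      mul_nonneg (Real.rpow_nonneg (Nat.cast_nonneg p) σ')
        (Real.log_nonneg (by exact_mod_cast (hprimeX p hp).one_lt.le))
    calc ∑ p ∈ T, G p * Real.log p
        ≤ Real.log (3 * Px) ^ τ * ∑ p ∈ T, (p : ℝ) ^ σ' * Real.log p := hsumT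
      _ ≤ (3 * Cτ * Px ^ (1 / 8 : ℝ)) * (8 * (Px ^ σ' * Px ^ (1 / 8 : ℝ))) :=
          mul_le_mul hlogpow hsg hsg0 (by positivity)
      _ = 24 * Cτ * (Px ^ (1 / 8 : ℝ) * Px ^ σ' * Px ^ (1 / 8 : ℝ)) := by ring
      _ = 24 * Cτ * Px ^ (σ' + 1 / 4) := by
          have hexp₂ : (1 / 8 : ℝ) + σ' + 1 / 8 = σ' + 1 / 4 := by ring
          rw [← Real.rpow_add hPx0, ← Real.rpow_add hPx0, hexp₂]
  -- (4) assembling against the radical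
  have hpow₁ : P₁ ^ (κ + 5 / 4) ≤ P₁ ^ (29 / 2 : ℝ) :=
    Real.rpow_le_rpow_of_exponent_le hP₁1 (by linarith)
  have hpow₂ : Px ^ (σ' + 1 / 4) ≤ Px ^ (29 / 2 : ℝ) :=
    Real.rpow_le_rpow_of_exponent_le hPx1 (by rw [hσ']; linarith)
  have hΦ0 : 0 ≤ Φ := by
    rw [hΦ]; exact pow_nonneg (Real.log_nonneg (le_trans (by norm_num) (le_max_left _ _))) τ
  have hG0' : 0 ≤ ∑ p ∈ T, G p * Real.log p := Finset.sum_nonneg fun p hp =>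
    mul_nonneg (hG0 p) (Real.log_nonneg (by exact_mod_cast (hprimeX p hp).one_lt.le))
  calc Real.log c ≤ F n (∏ q ∈ S, q) * Φ * ∑ p ∈ T, G p * Real.log p := hsum
    _ ≤ (K * (2 * (m₀ : ℝ)) ^ τ * A * P₁ ^ (κ + 5 / 4)) * (2 ^ τ * Y ^ τ) *
        (24 * Cτ * Px ^ (σ' + 1 / 4)) := by
        apply mul_le_mul _ hGsum hG0' (by positivity)
        exact mul_le_mul hFle hΦY hΦ0 (by positivity)
    _ ≤ (K * (2 * (m₀ : ℝ)) ^ τ * A * P₁ ^ (29 / 2 : ℝ)) * (2 ^ τ * Y ^ τ) *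
        (24 * Cτ * Px ^ (29 / 2 : ℝ)) := by
        apply mul_le_mul _ (mul_le_mul_of_nonneg_left hpow₂ (by positivity)) (by positivity)
          (by positivity)
        apply mul_le_mul_of_nonneg_right _ (by positivity)
        exact mul_le_mul_of_nonneg_left hpow₁ (by positivity)
    _ = 24 * K * (2 * (m₀ : ℝ)) ^ τ * 2 ^ τ * Cτ * A * (Px * P₁) ^ (29 / 2 : ℝ) * Y ^ τ := by
        rw [Real.mul_rpow hPx0.le hP₁0.le]; ring
    _ = 24 * K * (2 * (m₀ : ℝ)) ^ τ * 2 ^ τ * (30 * ((τ : ℝ) + 1)) ^ τ * A *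
        (rad a b c : ℝ) ^ (29 / 2 : ℝ) * Real.log (max 3 (Real.log c)) ^ τ := by
        rw [hRad, hCτ, hY]

end StewartTijdemanPrincipal

open StewartTijdemanPrincipal

/-! ### Theorem D: the shape `(15, 0)` from a `p`-adic bound for principal units of `ℚ` -/

open StewartTijdemanGeneric in
/-- **Theorem D. Stewart–Tijdeman 1986 (`log c ≤ κ R^{15}`) from a `p`-adic bound for PRINCIPAL
UNITS of `ℚ` alone.** Hypothesis `hPU` (the only transcendence input): constants `K ≥ 0`,
`L ≥ 1`, `κ ∈ [0, 13]`, `σ ≥ 0`, `m₀ ≥ 1` with `σ + m₀ ≤ 14`, `τ ∈ ℕ`, such that for every prime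
`p`, every `k ≥ 1`, all POSITIVE RATIONALS `β₁, …, β_k` that are multiplicatively independent
(`∏ βⱼ^{cⱼ} = 1 ⇒ c = 0`) and congruent to `1` modulo `p^{m₀}` (`ord_p(βⱼ − 1) ≥ m₀`: principal
units of level `m₀`, the natural domain of the `p`-adic logarithm and of Baker's method — for
`m₀ ≥ 1` and odd `p`, or `m₀ ≥ 2`, `|log_p βⱼ|_p = |βⱼ − 1|_p`), and all `y ∈ (ℤ ∖ {0})^k`:
`ord_p(β₁^{y₁}⋯β_k^{y_k} − 1) ≤ K L^k k^{κk} p^σ (∏ⱼ max(1, h(βⱼ))) (log max(3, maxⱼ |yⱼ|))^τ`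
(`h` the logarithmic height, `ord_p = padicValRat p`). Conclusion: the named fact
`stewartTijdeman1986_upperBound` (`BakerShapeBound 15 0`) [cite: StewartTijdeman1986, Theorem 1
(upper bound), as quoted in Waldschmidt2014 §2 (PDF p. 3)].

Compared with Theorem A of the sibling file (a bound for families of distinct PRIMES `qᵢ`, which
are `p`-adic units but not principal units), the reduction to principal units is done here, at the
cost `p^{m₀}` in `σ` and `1` in `κ`: the exponent vectors `x` with `∏ qᵢ^{xᵢ} ≡ 1 (mod p^{m₀})`
form a lattice of index `≤ p^{m₀}` (`exists_principal_lattice`), which by Minkowski's second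
theorem (the tree's `Dioph.exists_directional_system_prod_mul_volume_le`, Evertse–Győry Thm 4.3.1)
contains independent `w₁, …, wₙ` with `∏ ‖w_k‖_∞ ≤ p^{m₀}`
(`exists_indep_prod_norm_le_card_quotient`); the `β_k = ∏ qᵢ^{w_{k i}}` are principal units with
`∏ max(1, h(β_k)) ≤ p^{m₀} (2 log ∏ qᵢ)ⁿ`, and `det(w) · e = ∑ y_k w_k` turns
`ord_p(∏ qᵢ^{eᵢ} − 1) ≤ ord_p((∏ qᵢ^{eᵢ})^{det w} − 1)` into a form in the `β_k`
(`primeFamilyBound_of_principalUnitBound`). Then the Stewart–Tijdeman summation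
(`sum_padicPart_le_general`, `abc_log_le_of_principalClass`) and the endgame
`bakerShapeBound_fifteen_of_loglog`. No archimedean estimate is used. [folklore] -/
theorem stewartTijdeman1986_of_principalUnitPadicBound {K L κ σ : ℝ} {τ m₀ : ℕ}
    (hK : 0 ≤ K) (hL : 1 ≤ L) (hκ0 : 0 ≤ κ) (hκ : κ ≤ 13) (hσ0 : 0 ≤ σ) (hm : 1 ≤ m₀)
    (hσm : σ + m₀ ≤ 14)
    (hPU : ∀ (p k : ℕ) (β : Fin k → ℚ) (y : Fin k → ℤ), p.Prime → 1 ≤ k →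
      (∀ j, 0 < β j) →
      (∀ c : Fin k → ℤ, ∏ j, β j ^ c j = 1 → c = 0) →
      (∀ j, (m₀ : ℤ) ≤ padicValRat p (β j - 1)) →
      (∀ j, y j ≠ 0) →
      (padicValRat p (∏ j, β j ^ y j - 1) : ℝ) ≤
        K * L ^ k * (k : ℝ) ^ (κ * k) * (p : ℝ) ^ σ * (∏ j, max 1 (logHeight₁ (β j))) *
          Real.log (max 3 ((Finset.univ.sup fun j => (y j).natAbs : ℕ) : ℝ)) ^ τ) :
    stewartTijdeman1986_upperBound := by
  classical
  have hC1 : (1 : ℝ) ≤ 2 * L * Real.exp κ * 4 ^ τ * (8 * Real.exp 1) := by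
    have h1 : (1 : ℝ) ≤ Real.exp κ := Real.one_le_exp hκ0
    have h2 : (1 : ℝ) ≤ (4 : ℝ) ^ τ := one_le_pow₀ (by norm_num)
    have h3 : (1 : ℝ) ≤ 8 * Real.exp 1 := by nlinarith [Real.add_one_le_exp (1 : ℝ)]
    have h4 : (1 : ℝ) ≤ 2 * L := by linarith
    calc (1 : ℝ) = 1 * 1 * 1 * 1 := by ring
      _ ≤ 2 * L * Real.exp κ * 4 ^ τ * (8 * Real.exp 1) := by
          apply mul_le_mul (mul_le_mul (mul_le_mul h4 h1 zero_le_one (by linarith)) h2 zero_le_one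
            (by positivity)) h3 zero_le_one (by positivity)
  obtain ⟨A, hA1, hA⟩ := exists_pow_card_le_prod_rpow hC1 (by norm_num : (0 : ℝ) < 1 / 8)
  have hA0 : 0 ≤ A := zero_le_one.trans hA1
  have hP := primeFamilyBound_of_principalUnitBound hK hL hκ0 hm hPU
  set M₀ : ℝ := 24 * K * (2 * (m₀ : ℝ)) ^ τ * 2 ^ τ * (30 * ((τ : ℝ) + 1)) ^ τ * A with hM₀
  have hM0 : 0 ≤ M₀ := by rw [hM₀]; positivity
  refine bakerShapeBound_fifteen_of_loglog (μ := 29 / 2) (τ := τ) (M := M₀ + 1)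
    (by norm_num) le_rfl (by positivity) fun a b c ht => ?_
  have hR1 : (1 : ℝ) ≤ (rad a b c : ℝ) := one_le_rad_real a b c
  have hRμ : (1 : ℝ) ≤ (rad a b c : ℝ) ^ (29 / 2 : ℝ) := Real.one_le_rpow hR1 (by norm_num)
  set Y : ℝ := Real.log (max 3 (Real.log c)) with hY
  have hl3 : 1 ≤ Real.log 3 := by
    rw [Real.le_log_iff_exp_le (by norm_num)]
    exact Real.exp_one_lt_d9.le.trans (by norm_num)
  have hY1 : 1 ≤ Y := hl3.trans (Real.log_le_log (by norm_num) (le_max_left _ _))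
  have hYτ : 1 ≤ Y ^ τ := one_le_pow₀ hY1
  rcases eq_or_ne a b with rfl | hab
  · -- `a = b = 1`, `c = 2`
    obtain ⟨ha, -, habc, hcop⟩ := ht
    have ha1 : a = 1 := Nat.Coprime.eq_one_of_dvd hcop (dvd_refl a)
    have hc2 : c = 2 := by omega
    subst hc2
    have h2 : Real.log ((2 : ℕ) : ℝ) ≤ 1 := by
      push_cast; linarith only [Real.log_two_lt_d9]
    calc Real.log ((2 : ℕ) : ℝ) ≤ 1 := h2
      _ ≤ (M₀ + 1) * (rad a a 2 : ℝ) ^ (29 / 2 : ℝ) * Y ^ τ := by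
          have h1 : (1 : ℝ) ≤ M₀ + 1 := by linarith
          calc (1 : ℝ) = 1 * 1 * 1 := by ring
            _ ≤ (M₀ + 1) * (rad a a 2 : ℝ) ^ (29 / 2 : ℝ) * Y ^ τ :=
                mul_le_mul (mul_le_mul h1 hRμ zero_le_one (by positivity)) hYτ zero_le_one
                  (by positivity)
  · have h := abc_log_le_of_principalClass hK hL hκ0 hκ hσ0 hσm hP hA0 hA ht hab
    rw [← hM₀] at h
    calc Real.log c ≤ M₀ * (rad a b c : ℝ) ^ (29 / 2 : ℝ) * Y ^ τ := h
      _ ≤ (M₀ + 1) * (rad a b c : ℝ) ^ (29 / 2 : ℝ) * Y ^ τ := by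
          apply mul_le_mul_of_nonneg_right _ (by positivity)
          apply mul_le_mul_of_nonneg_right _ (by positivity)
          linarith

end Literature.Barriers.ABC

end
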